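import Literature.Analysis.FluidPDE.OnsagerCCFSFlux
import Literature.Analysis.FunctionSpaces.TorusCommutatorEstimate
import Literature.Analysis.FunctionSpaces.TorusSpaceTimeConvolution
import Literature.Analysis.FunctionSpaces.TorusTimeAverage
import Literature.Analysis.FunctionSpaces.TorusFluidGlue
import Literature.Analysis.FunctionSpaces.TimeMollification
import Literature.Analysis.FunctionSpaces.DistributionalConstancy
import HarnessLib

/-!
# Sharp Onsager rigidity (CCFS 2008, Thm 3.3): the mollified energy balance — discharge of F₁

Sorry-free proof of the named fact `Literature.Analysis.FunctionSpaces.Torus.IsWeakEulerSolutionOn.energyBalance_vecConv` (F₁)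
of `Literature/Analysis/FluidPDE/OnsagerCCFSFlux`, i.e. of equation (11) of
Cheskidov–Constantin–Friedlander–Shvydkoy 2008, §3.2 in the tree's mollifier transcription on
`T^d`: for a weak Euler solution `u` on `T^d × (0,T)` with `u ∈ L³_{t,x}`, the torus mollifier
`K = K_ε` and a cut-off `θ ∈ C_c^∞(0,T)`,
`∫₀ᵀ θ'(t) E(u(t) ⋆ K) dt = -∫₀ᵀ θ(t) Π_K[u(t)] dt`, `Π_K[v] = ∫ Tr[((v ⊗ v) ⋆ K) · ∇(v ⋆ K)]`
(CCFS, §3.1: "This justifies the use of physical space mollifications of `u` as test functions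
`ψ`"; §3.2: "substituting the test function `ψ = S_Q² u` into the weak formulation of the Euler
equation we obtain" the mollified energy balance (11)).

## The proof, as formalised (theorem `Torus.energyBalance_vecConv_holds`)

The printed argument tests the weak formulation with `(u ⋆ K) ⋆ K`, which is not a legitimate
test field (no time regularity). The standard repair, formalised here, mollifies in time as well:
with `ū = 𝟙_{(0,T)} u` (`Torus.stBar`, extended by zero; strongly measurable representatives
`Uⱼ` of its components), normalised even bumps `ρₙ` on `ℝ` with radii `→ 0` and smaller than
the distance of `supp θ` to `{0, T}`, the fields
`ψₙ = ρₙ ⋆ₜ (θ · ((ρₙ ⋆ₜ ū) ⋆ₓ K)) ⋆ₓ K` (`Torus.cetTest`, componentwise; `Torus.vecField`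
reassembles the vector field) are
* smooth in space–time (`Torus.contDiff_stLift_cetTest`, from `Torus.contDiff_top_stLift_stConv`
  of `FunctionSpaces/TorusSpaceTimeConvolution`), compactly supported in `(0,T)` in time
  (`Torus.cetTest_eq_zero_of_dist`) and divergence free (`Torus.isDivFree_cetTest`: a.e. slice
  of `ū` is weakly divergence free, and `∂ᵢ` passes onto the space kernel);
hence admissible in `Torus.IsWeakNSSolutionOn` (`ν = 0`). In the resulting identity
(`Torus.weakForm_rewrite` puts it on `ℝ × T^d` with the representatives `Uⱼ`):
* the time-derivative pairing is computed *exactly*: by evenness of `ρₙ`, `K` (adjointness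
  `Torus.integral_mul_convolution_comm`, oddness of `ρₙ'`) it equals
  `½ ∫ θ'(s) ‖(ρₙ ⋆ₜ ū)(s) ⋆ K‖²_{L²} ds` (`Torus.integral_mul_timeDeriv_cetTest`; no Friedrichs
  commutator is needed), which tends to `∫ θ' E(u ⋆ K)` as `n → ∞`
  (`Torus.tendsto_integral_cutoff_sq_timeConv`: `L²` continuity of time mollification, the
  tree's `TimeMollification`);
* the convective pairing `∑ᵢⱼ ∫ UⱼUᵢ ∂ᵢψₙⱼ` has `∂ᵢψₙⱼ = ρₙ ⋆ₜ (θ · (ρₙ ⋆ₜ Bⱼᵢ))`,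
  `Bⱼᵢ = (Uⱼ ⋆ₓ K) ⋆ₓ ∂ᵢK` (`Torus.partialDeriv_cetTest_eq`), which converges in `L³_{t,x}` to
  `θ Bⱼᵢ` (`Torus.tendsto_eLpNorm_iteratedTimeConv_sub`), while `UⱼUᵢ ∈ L^{3/2}_{t,x}`; the
  limit pairing is identified with `∫ θ Π_K[u]` through evenness of `K` once more
  (`Torus.integral_sum_mul_cutoff_sliceB_eq`).
Equating the limits gives (11). The hypothesis `u ∈ L³_{t,x}` of F₁ is exactly what makes the
convective pairing converge.

## Definitions in this file

Four proof-internal constructions, stated as `def`s because a dozen lemmas are proved about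
each: `Torus.sliceConv U K` (space mollification of `U : ℝ × T^d → ℝ` slice by slice),
`Torus.cetTest ρ K θ U` (the scalar test-field component above, through `Torus.stConv`),
`Torus.vecField ψc` (the `EuclideanSpace` field with components `ψc j`), `Torus.stBar T u`
(extension of `uncurry u` by zero off `(0,T) × T^d`). Relation to the sibling route's
`FunctionSpaces/TorusMollifiedFields` (Constantin–E–Titi, `onsager_rigidity`): for `U` the
components of a velocity field, `vecField (fun j => cetTest ρ (kernel ε) θ (U j))` is its
`cetTestField φ ε θ` written through `stConv` (uncurried, so that the smoothness and derivative
formulas of `TorusSpaceTimeConvolution` apply verbatim); nothing from that file is restated.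

## Mathlib search

Mathlib (this pin) supplies: convolution on `ℝ` and its `L^p` continuity ingredients (used via
the tree's `TimeMollification.tendsto_eLpNorm_timeConv_sub`), `ContDiffBump` (normalised bumps,
`ContDiffBump.normed_neg`), Hölder (`MemLp.mul`, `eLpNorm_smul_le_mul_eLpNorm`), Fubini
(`integral_prod`, `Integrable.integral_prod_left`), `contDiff_piLp'`; it has no weak-formulation
or space–time test-field API (searched `UnitAddTorus`/`AddCircle` with `convolution`,
`divergence`, `testFunction`).

## References

* A. Cheskidov, P. Constantin, S. Friedlander, R. Shvydkoy, *Energy conservation and Onsager's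
  conjecture for the Euler equations*, Nonlinearity 21 (2008) = arXiv:0704.0759, §3.1 (last
  paragraph), §3.2, (9)–(11).
* P. Constantin, W. E, E. S. Titi, Comm. Math. Phys. 165 (1994), 207–209, p. 208 ("The extra
  arguments needed to mollify in time are straightforward").
-/

noncomputable section

open MeasureTheory TopologicalSpace Set Function Filter Topology Metric
open scoped ENNReal NNReal Convolution ContDiff InnerProductSpace

namespace Literature.Analysis.FluidPDE

namespace Torus

variable {d : Type*} [Fintype d]

/-! ## Space mollification of a space–time field, slice by slice -/

section SliceConv

/-- The slice-wise space mollification `(s, x) ↦ (U(s, ·) ⋆ K)(x)` of `U : ℝ × T^d → ℝ`. [folklore] -/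
def sliceConv (U : ℝ × UnitAddTorus d → ℝ) (K : UnitAddTorus d → ℝ) : ℝ → UnitAddTorus d → ℝ :=
  fun s x => ((fun z => U (s, z)) ⋆ K) x

variable {U : ℝ × UnitAddTorus d → ℝ} {K : UnitAddTorus d → ℝ}

/-- Slice-wise mollification of a jointly (strongly) measurable field is jointly strongly
measurable (parametric integral, Mathlib's `StronglyMeasurable.integral_prod_right'`). [folklore] -/
theorem stronglyMeasurable_uncurry_sliceConv (hU : StronglyMeasurable U) (hK : Continuous K) :
    StronglyMeasurable (uncurry (sliceConv U K)) := by
  have h1 : StronglyMeasurable fun q : (ℝ × UnitAddTorus d) × UnitAddTorus d =>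
      U (q.1.1, q.2) * K (q.1.2 - q.2) :=
    (hU.comp_measurable (measurable_fst.fst.prodMk measurable_snd)).mul
      (hK.measurable.comp (measurable_fst.snd.sub measurable_snd)).stronglyMeasurable
  have h2 := h1.integral_prod_right' (ν := (volume : Measure (UnitAddTorus d)))
  have heq : uncurry (sliceConv U K) = fun p : ℝ × UnitAddTorus d =>
      ∫ z, U (p.1, z) * K (p.2 - z) := by
    funext p
    simp only [uncurry, sliceConv, convolution_lsmul, smul_eq_mul]
  rw [heq]
  exact h2

/-- **Fibrewise Young inequality for slice-wise mollification**: `‖U ⋆ₓ K‖_{Lᵖ(ℝ × T^d)} ≤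
‖K‖_{L¹} ‖U‖_{Lᵖ(ℝ × T^d)}`, `1 ≤ p < ∞` (Young on each time slice, `Torus.eLpNorm_convolution_le`,
and Tonelli). [folklore] -/
theorem eLpNorm_uncurry_sliceConv_le (hU : StronglyMeasurable U) (hK : Continuous K) {p : ℝ≥0∞}
    (hp : 1 ≤ p) (hp' : p ≠ ⊤) :
    eLpNorm (uncurry (sliceConv U K)) p ((volume : Measure ℝ).prod volume) ≤
      (∫⁻ y, ‖K y‖ₑ) * eLpNorm U p ((volume : Measure ℝ).prod volume) := by
  have hp0 : p ≠ 0 := (zero_lt_one.trans_le hp).ne'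
  have hpr : 0 < p.toReal := ENNReal.toReal_pos hp0 hp'
  have hWm := stronglyMeasurable_uncurry_sliceConv hU hK
  rw [eLpNorm_eq_lintegral_rpow_enorm_toReal hp0 hp', eLpNorm_eq_lintegral_rpow_enorm_toReal hp0 hp']
  -- `(a * b^(1/p))` form: raise Young to the power `p` slice-wise
  have hslice : ∀ s, ∫⁻ x, ‖uncurry (sliceConv U K) (s, x)‖ₑ ^ p.toReal ≤
      (∫⁻ y, ‖K y‖ₑ) ^ p.toReal * ∫⁻ x, ‖U (s, x)‖ₑ ^ p.toReal := by
    intro s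
    have hUs : AEStronglyMeasurable (fun z => U (s, z)) volume :=
      (hU.comp_measurable (measurable_const.prodMk measurable_id)).aestronglyMeasurable
    have h := FunctionSpaces.Torus.eLpNorm_convolution_le (d := d) hUs hK.aestronglyMeasurable hp
    have h' := ENNReal.rpow_le_rpow h hpr.le
    rw [eLpNorm_eq_eLpNorm' hp0 hp', eLpNorm_eq_eLpNorm' hp0 hp', ENNReal.mul_rpow_of_nonneg _ _ hpr.le,
      ← lintegral_rpow_enorm_eq_rpow_eLpNorm' hpr, ← lintegral_rpow_enorm_eq_rpow_eLpNorm' hpr] at h'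
    exact h'
  rw [lintegral_prod _ (hWm.aestronglyMeasurable.enorm.pow_const _),
    lintegral_prod _ (hU.aestronglyMeasurable.enorm.pow_const _)]
  calc (∫⁻ s, ∫⁻ x, ‖uncurry (sliceConv U K) (s, x)‖ₑ ^ p.toReal) ^ (1 / p.toReal)
      ≤ (∫⁻ s, (∫⁻ y, ‖K y‖ₑ) ^ p.toReal * ∫⁻ x, ‖U (s, x)‖ₑ ^ p.toReal) ^ (1 / p.toReal) :=
        ENNReal.rpow_le_rpow (lintegral_mono hslice) (by positivity)
    _ = (∫⁻ y, ‖K y‖ₑ) * (∫⁻ s, ∫⁻ x, ‖U (s, x)‖ₑ ^ p.toReal) ^ (1 / p.toReal) := by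
        rw [lintegral_const_mul' _ _ (ENNReal.rpow_ne_top_of_nonneg hpr.le ?_), ENNReal.mul_rpow_of_nonneg _ _
          (by positivity), ← ENNReal.rpow_mul, mul_one_div_cancel hpr.ne', ENNReal.rpow_one]
        exact hK.integrable_unitAddTorus.2.ne

end SliceConv

/-! ## Two more glue lemmas -/

section Glue

variable [DecidableEq d]

omit [DecidableEq d] in
/-- A.e. time slice of an `L³_{t,x}` field is in `L³(T^d)` (the `p = 3` case of
`Torus.ae_memLp_two_of_lintegral`, `OnsagerCCFSEnergyProofs`). [folklore] -/
theorem ae_memLp_three_of_lintegral {S : Set ℝ} {u : ℝ → UnitAddTorus d → EuclideanSpace ℝ d}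
    (hm : AEStronglyMeasurable (uncurry u) ((volume.restrict S).prod volume))
    (h3 : ∫⁻ t in S, ∫⁻ x, ‖u t x‖ₑ ^ 3 < ⊤) :
    ∀ᵐ t ∂(volume.restrict S), MemLp (u t) 3 volume := by
  have hsec : ∀ᵐ t ∂(volume.restrict S), AEStronglyMeasurable (u t) volume := hm.prodMk_left
  have hmeas : AEMeasurable (fun t => ∫⁻ x, ‖u t x‖ₑ ^ 3) (volume.restrict S) :=
    ((hm.enorm.pow_const 3)).lintegral_prod_right'
  have hfin : ∀ᵐ t ∂(volume.restrict S), ∫⁻ x, ‖u t x‖ₑ ^ 3 < ⊤ := ae_lt_top' hmeas h3.ne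
  filter_upwards [hsec, hfin] with t ht htfin
  refine ⟨ht, ?_⟩
  rw [eLpNorm_eq_lintegral_rpow_enorm_toReal (by norm_num) (by norm_num)]
  refine ENNReal.rpow_lt_top_of_nonneg (by norm_num) (ne_of_lt ?_)
  have h3r : ((3 : ℝ≥0∞)).toReal = ((3 : ℕ) : ℝ) := by norm_num
  simp_rw [h3r, ENNReal.rpow_natCast]
  exact htfin

/-- `∑ⱼ (vⱼ ⋆ ∂ⱼK) = 0` pointwise for an integrable weakly divergence-free `v` (the pointwise form of
`Torus.isDivFree_vecConv`, `OnsagerCCFSFluxEstimateProofs`, for merely integrable `v`). [folklore] -/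
theorem sum_convolution_partialDeriv_eq_zero {v : UnitAddTorus d → EuclideanSpace ℝ d}
    (hv : Integrable v volume) (hdiv : FunctionSpaces.Torus.IsWeaklyDivFree v) {K : UnitAddTorus d → ℝ} (hK : FunctionSpaces.Torus.IsSmooth K)
    (x : UnitAddTorus d) : ∑ i, ((fun y => v y i) ⋆ FunctionSpaces.Torus.partialDeriv i K) x = 0 := by
  have hK1 : FunctionSpaces.Torus.IsContDiff 1 K := hK.isContDiff (by simp)
  have hvi : ∀ i, Integrable (fun y => v y i) volume := fun i =>
    (EuclideanSpace.proj (𝕜 := ℝ) i).integrable_comp hv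
  have h1 : ∀ i, ((fun y => v y i) ⋆ FunctionSpaces.Torus.partialDeriv i K) x = ∫ t, FunctionSpaces.Torus.partialDeriv i K (x - t) * v t i := by
    intro i
    rw [convolution_lsmul]
    refine integral_congr_ae (Eventually.of_forall fun t => ?_)
    show v t i • FunctionSpaces.Torus.partialDeriv i K (x - t) = FunctionSpaces.Torus.partialDeriv i K (x - t) * v t i
    rw [smul_eq_mul, mul_comm]
  have hint : ∀ i, Integrable (fun t => FunctionSpaces.Torus.partialDeriv i K (x - t) * v t i) volume := fun i => by
    obtain ⟨C, hC⟩ := FunctionSpaces.Torus.exists_forall_norm_le_of_continuous (hK.partialDeriv i).continuous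
    exact (hvi i).bdd_mul (((hK.partialDeriv i).continuous.comp
      (continuous_const.sub continuous_id)).aestronglyMeasurable) (Eventually.of_forall fun t => hC _)
  have h2 : ∀ t, ∑ i, FunctionSpaces.Torus.partialDeriv i K (x - t) * v t i =
      -⟪v t, FunctionSpaces.Torus.gradient (fun y => K (x - y)) t⟫_ℝ := by
    intro t
    rw [FunctionSpaces.Torus.gradient_comp_sub_left, inner_neg_right, neg_neg, FunctionSpaces.Torus.gradient_eq_sum_partialDeriv hK1, inner_sum]
    refine Finset.sum_congr rfl fun i _ => ?_
    rw [real_inner_smul_right, EuclideanSpace.inner_single_right]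
    simp [mul_comm]
  simp_rw [h1]
  rw [← integral_finsetSum _ fun i _ => hint i]
  simp_rw [h2]
  rw [integral_neg, hdiv _ (hK.comp_sub_left x), neg_zero]

end Glue

/-! ## F1: the mollified energy balance — the test field and its admissibility -/

section TestField

variable [DecidableEq d]

/-- The doubly space-mollified, time-mollified, cut-off test field built from one component
`U : ℝ × T^d → ℝ` of the (extended) velocity: `ψ = ((θ ⊗ 1) · w̃) ⋆_{t,x} (ρ ⊗ K)` where
`w̃ = U ⋆_{t,x} (ρ ⊗ K)`; i.e. `cetTest ρ K θ U = stConv ρ K (θ ⊗ stConv ρ K U)`. This is the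
time-regularised form of the test field "`S_Q² u`" of CCFS 2008, §3.2 (there a Littlewood–Paley
cut-off in space and no time mollification; §3.1 defers the admissibility of mollified
solutions as test fields to "an approximation argument … a rather academic point"), i.e. the
classical Constantin–E–Titi repair of mollifying in time as well (1994, p. 208: "The extra
arguments needed to mollify in time are straightforward"). [folklore] -/
def cetTest (ρ : ℝ → ℝ) (K : UnitAddTorus d → ℝ) (θ : ℝ → ℝ) (U : ℝ × UnitAddTorus d → ℝ) :
    ℝ → UnitAddTorus d → ℝ :=
  FunctionSpaces.Torus.stConv ρ K fun p => θ p.1 * FunctionSpaces.Torus.stConv ρ K U p.1 p.2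

variable {ρ θ : ℝ → ℝ} {K : UnitAddTorus d → ℝ} {U : ℝ × UnitAddTorus d → ℝ}

omit [DecidableEq d] in
/-- The space–time mollification of an integrable field by bounded kernels is bounded. [folklore] -/
theorem exists_abs_stConv_le (hU : Integrable U ((volume : Measure ℝ).prod volume))
    (hρ : Continuous ρ) (hρc : HasCompactSupport ρ) (hK : Continuous K) :
    ∃ C, ∀ t x, |FunctionSpaces.Torus.stConv ρ K U t x| ≤ C := by
  obtain ⟨A, hA⟩ := hρ.bounded_above_of_compact_support hρc
  obtain ⟨B, hB⟩ := FunctionSpaces.Torus.exists_forall_norm_le_of_continuous hK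
  refine ⟨A * B * ∫ p, ‖U p‖ ∂((volume : Measure ℝ).prod volume), fun t x => ?_⟩
  rw [FunctionSpaces.Torus.stConv, ← Real.norm_eq_abs]
  calc ‖∫ p, U p * (ρ (t - p.1) * K (x - p.2)) ∂((volume : Measure ℝ).prod volume)‖
      ≤ ∫ p, ‖U p‖ * (A * B) ∂((volume : Measure ℝ).prod volume) := by
        refine norm_integral_le_of_norm_le (hU.norm.mul_const _) (Eventually.of_forall fun p => ?_)
        rw [norm_mul, norm_mul]
        exact mul_le_mul_of_nonneg_left (mul_le_mul (hA _) (hB _) (norm_nonneg _)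
          ((norm_nonneg _).trans (hA 0))) (norm_nonneg _)
    _ = A * B * ∫ p, ‖U p‖ ∂((volume : Measure ℝ).prod volume) := by
        rw [integral_mul_const]; ring

omit [DecidableEq d] in
/-- The cut-off inner field `(s, z) ↦ θ(s) w̃(s, z)` is integrable on `ℝ × T^d` (bounded, and
supported in `tsupport θ × T^d`). [folklore] -/
theorem integrable_cutoff_stConv (hU : Integrable U ((volume : Measure ℝ).prod volume))
    (hρ : ContDiff ℝ ∞ ρ) (hρc : HasCompactSupport ρ) (hK : FunctionSpaces.Torus.IsSmooth K) (hθ : ContDiff ℝ ∞ θ)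
    (hθc : HasCompactSupport θ) :
    Integrable (fun p : ℝ × UnitAddTorus d => θ p.1 * FunctionSpaces.Torus.stConv ρ K U p.1 p.2)
      ((volume : Measure ℝ).prod volume) := by
  obtain ⟨C, hC⟩ := exists_abs_stConv_le hU hρ.continuous hρc hK.continuous
  -- `θ ⊗ 1` is integrable on `ℝ × T^d` (compact support in time, probability measure in space)
  have hθi : Integrable (fun p : ℝ × UnitAddTorus d => θ p.1) ((volume : Measure ℝ).prod volume) := by
    have h1 : Integrable θ (volume : Measure ℝ) := hθ.continuous.integrable_of_hasCompactSupport hθc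
    have := h1.mul_prod (f := θ) (g := fun _ : UnitAddTorus d => (1 : ℝ))
      (integrable_const (μ := (volume : Measure (UnitAddTorus d))) (1 : ℝ))
    simpa using this
  have hcont : Continuous (uncurry (FunctionSpaces.Torus.stConv ρ K U)) :=
    FunctionSpaces.Torus.continuous_uncurry_of_continuous_stLift (FunctionSpaces.Torus.contDiff_top_stLift_stConv hU hρ hρc hK).continuous
  refine hθi.mul_bdd (c := C) hcont.aestronglyMeasurable (Eventually.of_forall fun p => ?_)
  rw [Real.norm_eq_abs]
  exact hC p.1 p.2

omit [DecidableEq d] in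
/-- **The test field has a smooth space–time lift.** [folklore] -/
theorem contDiff_stLift_cetTest (hU : Integrable U ((volume : Measure ℝ).prod volume))
    (hρ : ContDiff ℝ ∞ ρ) (hρc : HasCompactSupport ρ) (hK : FunctionSpaces.Torus.IsSmooth K) (hθ : ContDiff ℝ ∞ θ)
    (hθc : HasCompactSupport θ) : ContDiff ℝ ∞ (FunctionSpaces.Torus.stLift (cetTest ρ K θ U)) :=
  FunctionSpaces.Torus.contDiff_top_stLift_stConv (integrable_cutoff_stConv hU hρ hρc hK hθ hθc) hρ hρc hK

omit [DecidableEq d] in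
/-- **Time support of the test field**: if `θ` vanishes off `[a, b]` and `ρ` off `(-δ, δ)`, then
`cetTest ρ K θ U (t) = 0` for `t ≤ a - δ` and for `b + δ ≤ t`. [folklore] -/
theorem cetTest_eq_zero_of_dist {a b δ : ℝ} (hθab : ∀ s, θ s ≠ 0 → s ∈ Icc a b)
    (hρδ : ∀ r, ρ r ≠ 0 → |r| < δ) {t : ℝ} (ht : t ≤ a - δ ∨ b + δ ≤ t) (x : UnitAddTorus d) :
    cetTest ρ K θ U t x = 0 := by
  rw [cetTest, FunctionSpaces.Torus.stConv]
  refine integral_eq_zero_of_ae (Eventually.of_forall fun p => ?_)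
  by_cases hθp : θ p.1 = 0
  · simp [hθp]
  by_cases hρp : ρ (t - p.1) = 0
  · simp [hρp]
  exfalso
  have h1 := hθab _ hθp
  have h2 := hρδ _ hρp
  rw [abs_lt] at h2
  rcases ht with ht | ht
  · linarith [h1.1]
  · linarith [h1.2]

omit [DecidableEq d] in
/-- Slices of a field with smooth space–time lift are smooth. [folklore] -/
theorem isSmooth_slice_of_contDiff_stLift {F' : Type*} [NormedAddCommGroup F'] [NormedSpace ℝ F']
    {ψ : ℝ → UnitAddTorus d → F'} (hψ : ContDiff ℝ ∞ (FunctionSpaces.Torus.stLift ψ)) (t : ℝ) : FunctionSpaces.Torus.IsSmooth (ψ t) :=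
  hψ.comp (contDiff_prodMk_right t)

/-- Time mollification of a finite sum. [folklore] -/
theorem timeConv_finset_sum {ι : Type*} (s : Finset ι) {g : ι → ℝ → ℝ} {ρ : ℝ → ℝ} (t : ℝ)
    (hg : ∀ i ∈ s, Integrable (fun τ => ρ τ * g i (t - τ)) volume) :
    (ρ ⋆ fun r => ∑ i ∈ s, g i r) t = ∑ i ∈ s, (ρ ⋆ g i) t := by
  simp only [convolution_lsmul, smul_eq_mul, Finset.mul_sum]
  exact integral_finsetSum _ hg

/-- **The divergence of the inner mollified field vanishes**: with `w̃ⱼ = stConv ρ K Uⱼ`,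
`∑ⱼ ∂ⱼ w̃ⱼ(s, z) = (ρ ⋆ₜ (r ↦ ∑ⱼ (Uⱼ(r,·) ⋆ ∂ⱼK)(z)))(s) = 0` as soon as
`∑ⱼ (Uⱼ(r,·) ⋆ ∂ⱼK)(z) = 0` for a.e. `r` (weak divergence-freeness of the slices). [folklore] -/
theorem sum_partialDeriv_stConv_eq_zero {Uc : d → ℝ × UnitAddTorus d → ℝ}
    (hU : ∀ j, Integrable (Uc j) ((volume : Measure ℝ).prod volume))
    (hρ : ContDiff ℝ ∞ ρ) (hρc : HasCompactSupport ρ) (hK : FunctionSpaces.Torus.IsSmooth K)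
    (hdiv : ∀ᵐ r ∂(volume : Measure ℝ), ∀ z, ∑ j, ((fun y => Uc j (r, y)) ⋆ FunctionSpaces.Torus.partialDeriv j K) z = 0)
    (s : ℝ) (z : UnitAddTorus d) :
    ∑ j, FunctionSpaces.Torus.partialDeriv j (FunctionSpaces.Torus.stConv ρ K (Uc j) s) z = 0 := by
  have hρ1 : ContDiff ℝ 1 ρ := hρ.of_le (by norm_cast)
  have hK1 : FunctionSpaces.Torus.IsContDiff 1 K := hK.isContDiff (by simp)
  have h1 : ∀ j, FunctionSpaces.Torus.partialDeriv j (FunctionSpaces.Torus.stConv ρ K (Uc j) s) z =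
      (ρ ⋆ fun r => ((fun y => Uc j (r, y)) ⋆ FunctionSpaces.Torus.partialDeriv j K) z) s := fun j => by
    rw [FunctionSpaces.Torus.partialDeriv_stConv (hU j) hρ1 hρc hK1, FunctionSpaces.Torus.stConv_eq_timeConv (hU j) hρ.continuous hρc
      (hK.partialDeriv j).continuous]
  simp_rw [h1]
  -- integrability of the summands in `τ`
  obtain ⟨A, hA⟩ := hρ.continuous.bounded_above_of_compact_support hρc
  have hint : ∀ j, Integrable (fun τ => ρ τ * ((fun y => Uc j (s - τ, y)) ⋆ FunctionSpaces.Torus.partialDeriv j K) z)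
      volume := by
    intro j
    obtain ⟨B, hB⟩ := FunctionSpaces.Torus.exists_forall_norm_le_of_continuous (hK.partialDeriv j).continuous
    set Φ : ℝ × UnitAddTorus d → ℝ := fun q => ρ q.1 * (Uc j (s - q.1, q.2) * FunctionSpaces.Torus.partialDeriv j K (z - q.2))
      with hΦ
    have hmp : MeasurePreserving (fun p : ℝ × UnitAddTorus d => (s - p.1, p.2))
        ((volume : Measure ℝ).prod volume) ((volume : Measure ℝ).prod volume) :=
      ((volume : Measure ℝ).measurePreserving_sub_left s).prod (MeasurePreserving.id volume)
    have hU' : Integrable (fun p : ℝ × UnitAddTorus d => Uc j (s - p.1, p.2))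
        ((volume : Measure ℝ).prod volume) := (hmp.integrable_comp (hU j).aestronglyMeasurable).2 (hU j)
    have hΦi : Integrable Φ ((volume : Measure ℝ).prod volume) := by
      have h1 : Integrable (fun p : ℝ × UnitAddTorus d => Uc j (s - p.1, p.2) * FunctionSpaces.Torus.partialDeriv j K (z - p.2))
          ((volume : Measure ℝ).prod volume) :=
        hU'.mul_bdd ((hK.partialDeriv j).continuous.comp_aestronglyMeasurable
          ((measurable_const.sub measurable_snd).aestronglyMeasurable)) (Eventually.of_forall fun p => hB _)
      exact h1.bdd_mul (hρ.continuous.comp_aestronglyMeasurable measurable_fst.aestronglyMeasurable)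
        (Eventually.of_forall fun p => hA _)
    refine hΦi.integral_prod_left.congr (Eventually.of_forall fun τ => ?_)
    simp only [hΦ, convolution_lsmul, smul_eq_mul]
    rw [integral_const_mul]
  rw [← timeConv_finset_sum _ _ (fun j _ => hint j)]
  -- the summed integrand vanishes for a.e. `r`, hence its time mollification vanishes
  rw [convolution_lsmul]
  refine integral_eq_zero_of_ae ?_
  have hae : ∀ᵐ τ ∂(volume : Measure ℝ), ∑ j, ((fun y => Uc j (s - τ, y)) ⋆ FunctionSpaces.Torus.partialDeriv j K) z = 0 :=
    ((volume : Measure ℝ).measurePreserving_sub_left s).quasiMeasurePreserving.ae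
      (hdiv.mono fun r hr => hr z)
  filter_upwards [hae] with τ hτ
  simp only [smul_eq_mul, hτ, mul_zero, Pi.zero_apply]

/-- **The test field is divergence free at every time**: `div ψ(t) = (ρ ⋆ₜ (s ↦ θ(s) ((∑ⱼ ∂ⱼw̃ⱼ(s,·)) ⋆ K)(x)))(t) = 0`. [folklore] -/
theorem isDivFree_cetTest {Uc : d → ℝ × UnitAddTorus d → ℝ}
    (hU : ∀ j, Integrable (Uc j) ((volume : Measure ℝ).prod volume))
    (hρ : ContDiff ℝ ∞ ρ) (hρc : HasCompactSupport ρ) (hK : FunctionSpaces.Torus.IsSmooth K) (hθ : ContDiff ℝ ∞ θ)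
    (hθc : HasCompactSupport θ)
    (hdiv : ∀ᵐ r ∂(volume : Measure ℝ), ∀ z, ∑ j, ((fun y => Uc j (r, y)) ⋆ FunctionSpaces.Torus.partialDeriv j K) z = 0)
    (t : ℝ) : FunctionSpaces.Torus.IsDivFree fun x => WithLp.toLp 2 fun j => cetTest ρ K θ (Uc j) t x := by
  intro x
  have hρ1 : ContDiff ℝ 1 ρ := hρ.of_le (by norm_cast)
  have hK1 : FunctionSpaces.Torus.IsContDiff 1 K := hK.isContDiff (by simp)
  have hG : ∀ j, Integrable (fun p : ℝ × UnitAddTorus d => θ p.1 * FunctionSpaces.Torus.stConv ρ K (Uc j) p.1 p.2)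
      ((volume : Measure ℝ).prod volume) := fun j => integrable_cutoff_stConv (hU j) hρ hρc hK hθ hθc
  -- smoothness of the inner slices `w̃ⱼ(s, ·)`
  have hws : ∀ j s, FunctionSpaces.Torus.IsSmooth (FunctionSpaces.Torus.stConv ρ K (Uc j) s) := fun j s =>
    isSmooth_slice_of_contDiff_stLift (FunctionSpaces.Torus.contDiff_top_stLift_stConv (hU j) hρ hρc hK) s
  unfold FunctionSpaces.Torus.divergence
  have h1 : ∀ j, FunctionSpaces.Torus.partialDeriv j (fun y => (WithLp.toLp 2 fun j => cetTest ρ K θ (Uc j) t y) j) x =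
      (ρ ⋆ fun s => θ s * ((FunctionSpaces.Torus.partialDeriv j (FunctionSpaces.Torus.stConv ρ K (Uc j) s)) ⋆ K) x) t := by
    intro j
    have hfun : (fun y => (WithLp.toLp 2 fun j => cetTest ρ K θ (Uc j) t y) j) = cetTest ρ K θ (Uc j) t := rfl
    rw [hfun, cetTest, FunctionSpaces.Torus.partialDeriv_stConv (hG j) hρ1 hρc hK1,
      FunctionSpaces.Torus.stConv_eq_timeConv (hG j) hρ.continuous hρc (hK.partialDeriv j).continuous]
    congr 1
    funext s
    -- `(θ(s) w̃ⱼ(s,·)) ⋆ ∂ⱼK = θ(s) ((∂ⱼ w̃ⱼ(s,·)) ⋆ K)`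
    have hsm : ((fun z => θ s * FunctionSpaces.Torus.stConv ρ K (Uc j) s z) ⋆ FunctionSpaces.Torus.partialDeriv j K) x =
        θ s * ((FunctionSpaces.Torus.stConv ρ K (Uc j) s) ⋆ FunctionSpaces.Torus.partialDeriv j K) x := by
      simp only [convolution_lsmul, smul_eq_mul, mul_assoc]
      exact integral_const_mul _ _
    rw [hsm, FunctionSpaces.Torus.convolution_partialDeriv_right (hws j s) hK]
  simp_rw [h1]
  -- sum inside the time mollification, then the inner divergence vanishes identically
  obtain ⟨A, hA⟩ := hρ.continuous.bounded_above_of_compact_support hρc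
  have hint : ∀ j, Integrable (fun τ => ρ τ *
      (θ (t - τ) * ((FunctionSpaces.Torus.partialDeriv j (FunctionSpaces.Torus.stConv ρ K (Uc j) (t - τ))) ⋆ K) x)) volume := by
    intro j
    -- the second factor is continuous in `τ`: `∂ⱼ w̃ⱼ = stConv ρ (∂ⱼK) Uⱼ` is jointly smooth
    have hD : Continuous (uncurry (FunctionSpaces.Torus.stConv ρ (FunctionSpaces.Torus.partialDeriv j K) (Uc j))) :=
      FunctionSpaces.Torus.continuous_uncurry_of_continuous_stLift
        (FunctionSpaces.Torus.contDiff_top_stLift_stConv (hU j) hρ hρc (hK.partialDeriv j)).continuous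
    have hpd : ∀ r, FunctionSpaces.Torus.partialDeriv j (FunctionSpaces.Torus.stConv ρ K (Uc j) r) = FunctionSpaces.Torus.stConv ρ (FunctionSpaces.Torus.partialDeriv j K) (Uc j) r :=
      fun r => funext fun y => FunctionSpaces.Torus.partialDeriv_stConv (hU j) hρ1 hρc hK1 j r y
    have hF : Continuous fun r => ((FunctionSpaces.Torus.partialDeriv j (FunctionSpaces.Torus.stConv ρ K (Uc j) r)) ⋆ K) x := by
      simp_rw [hpd, convolution_lsmul, smul_eq_mul]
      have hc : Continuous (uncurry fun r y => FunctionSpaces.Torus.stConv ρ (FunctionSpaces.Torus.partialDeriv j K) (Uc j) r y * K (x - y)) :=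
        hD.mul (hK.continuous.comp (continuous_const.sub continuous_snd))
      have := continuous_parametric_integral_of_continuous
        (μ := (volume : Measure (UnitAddTorus d))) hc isCompact_univ
      simpa only [Measure.restrict_univ] using this
    have hcont : Continuous fun τ => ρ τ *
        (θ (t - τ) * ((FunctionSpaces.Torus.partialDeriv j (FunctionSpaces.Torus.stConv ρ K (Uc j) (t - τ))) ⋆ K) x) :=
      hρ.continuous.mul ((hθ.continuous.comp (continuous_const.sub continuous_id)).mul
        (hF.comp (continuous_const.sub continuous_id)))
    exact hcont.integrable_of_hasCompactSupport hρc.mul_right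
  rw [← timeConv_finset_sum _ _ (fun j _ => hint j)]
  have hzero : (fun r => ∑ j, θ r * ((FunctionSpaces.Torus.partialDeriv j (FunctionSpaces.Torus.stConv ρ K (Uc j) r)) ⋆ K) x) = fun _ => 0 := by
    funext r
    rw [← Finset.mul_sum, ← FunctionSpaces.Torus.finset_sum_convolution _ (fun j _ => ((hws j r).partialDeriv j).integrable)
      hK.continuous]
    have h0 : (fun y => ∑ j, FunctionSpaces.Torus.partialDeriv j (FunctionSpaces.Torus.stConv ρ K (Uc j) r) y) = fun _ => 0 :=
      funext fun y => sum_partialDeriv_stConv_eq_zero hU hρ hρc hK hdiv r y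
    rw [h0]
    simp [convolution_lsmul]
  rw [hzero]
  simp [convolution_lsmul]

omit [DecidableEq d] in
/-- **Duality for space–time mollification with an odd-even kernel**: for integrable `V`, `G`
on `ℝ × T^d`, an odd time kernel `η` (e.g. `ρ'` for even `ρ`) and an even space kernel `K`,
`∫ V · stConv η K G = -∫ G · stConv η K V` (Fubini on `(ℝ × T^d)²`). [folklore] -/
theorem integral_mul_stConv_odd_even {V G : ℝ × UnitAddTorus d → ℝ} {η : ℝ → ℝ}
    (hV : Integrable V ((volume : Measure ℝ).prod volume))
    (hG : Integrable G ((volume : Measure ℝ).prod volume)) (hη : Continuous η)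
    (hηc : HasCompactSupport η) (hηodd : ∀ r, η (-r) = -η r) (hK : Continuous K)
    (hKeven : ∀ z, K (-z) = K z) :
    ∫ q, V q * FunctionSpaces.Torus.stConv η K G q.1 q.2 ∂((volume : Measure ℝ).prod volume) =
      -∫ p, G p * FunctionSpaces.Torus.stConv η K V p.1 p.2 ∂((volume : Measure ℝ).prod volume) := by
  obtain ⟨A, hA⟩ := hη.bounded_above_of_compact_support hηc
  obtain ⟨B, hB⟩ := FunctionSpaces.Torus.exists_forall_norm_le_of_continuous hK
  set μ : Measure (ℝ × UnitAddTorus d) := (volume : Measure ℝ).prod volume with hμ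
  -- the integrand on `(ℝ × T^d)²`, variables `(q, p)`
  set Φ : (ℝ × UnitAddTorus d) × (ℝ × UnitAddTorus d) → ℝ :=
    fun w => V w.1 * (G w.2 * (η (w.1.1 - w.2.1) * K (w.1.2 - w.2.2))) with hΦ
  have hΦi : Integrable Φ (μ.prod μ) := by
    have h1 : Integrable (fun w : (ℝ × UnitAddTorus d) × (ℝ × UnitAddTorus d) => V w.1 * G w.2)
        (μ.prod μ) := hV.mul_prod hG
    have h2 := h1.mul_bdd (c := A * B) (g := fun w : (ℝ × UnitAddTorus d) × (ℝ × UnitAddTorus d) =>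
        η (w.1.1 - w.2.1) * K (w.1.2 - w.2.2)) ?_ (Eventually.of_forall fun w => ?_)
    · refine h2.congr (Eventually.of_forall fun w => ?_)
      simp only [hΦ]
      ring
    · exact ((hη.measurable.comp (measurable_fst.fst.sub measurable_snd.fst)).mul
        (hK.measurable.comp (measurable_fst.snd.sub measurable_snd.snd))).aestronglyMeasurable
    · rw [norm_mul]
      exact mul_le_mul (hA _) (hB _) (norm_nonneg _) ((norm_nonneg _).trans (hA 0))
  calc ∫ q, V q * FunctionSpaces.Torus.stConv η K G q.1 q.2 ∂μ = ∫ q, ∫ p, Φ (q, p) ∂μ ∂μ := by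
        refine integral_congr_ae (Eventually.of_forall fun q => ?_)
        simp only [FunctionSpaces.Torus.stConv, ← integral_const_mul, hΦ, hμ]
    _ = ∫ p, ∫ q, Φ (q, p) ∂μ ∂μ := integral_integral_swap hΦi
    _ = ∫ p, G p * (-FunctionSpaces.Torus.stConv η K V p.1 p.2) ∂μ := by
        refine integral_congr_ae (Eventually.of_forall fun p => ?_)
        simp only [FunctionSpaces.Torus.stConv, hμ, ← integral_neg, ← integral_const_mul]
        refine integral_congr_ae (Eventually.of_forall fun q => ?_)
        simp only [hΦ]
        rw [← neg_sub p.1 q.1, hηodd, ← neg_sub p.2 q.2, hKeven]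
        ring
    _ = -∫ p, G p * FunctionSpaces.Torus.stConv η K V p.1 p.2 ∂μ := by
        rw [← integral_neg]
        refine integral_congr_ae (Eventually.of_forall fun p => ?_)
        ring

omit [DecidableEq d] in
/-- **Time differentiability of a space–time mollification** (pointwise form of
`timeDeriv_stConv`). [folklore] -/
theorem hasDerivAt_stConv_time {F : ℝ × UnitAddTorus d → ℝ} {η : ℝ → ℝ}
    (hF : Integrable F ((volume : Measure ℝ).prod volume)) (hη : ContDiff ℝ 1 η)
    (hηc : HasCompactSupport η) (hK : FunctionSpaces.Torus.IsContDiff 1 K) (t : ℝ) (x : UnitAddTorus d) :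
    HasDerivAt (fun τ => FunctionSpaces.Torus.stConv η K F τ x) (FunctionSpaces.Torus.stConv (deriv η) K F t x) t := by
  obtain ⟨y, rfl⟩ := FunctionSpaces.Torus.proj_surjective x
  have hpath : HasDerivAt (fun τ : ℝ => ((τ, y) : ℝ × EuclideanSpace ℝ d)) (1, 0) t :=
    (hasDerivAt_id t).prodMk (hasDerivAt_const t y)
  have h := (FunctionSpaces.Torus.hasFDerivAt_stLift_stConv hF hη hηc hK (t, y)).comp_hasDerivAt t hpath
  have hfun : (FunctionSpaces.Torus.stLift (FunctionSpaces.Torus.stConv η K F) ∘ fun τ : ℝ => ((τ, y) : ℝ × EuclideanSpace ℝ d)) =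
      fun τ => FunctionSpaces.Torus.stConv η K F τ (FunctionSpaces.Torus.proj y) := funext fun τ => rfl
  rw [hfun] at h
  have hval : (∫ p, F p • FunctionSpaces.Torus.stProdKernelDeriv η K ((t, y) - (p.1, FunctionSpaces.Torus.reprc p.2)) ∂((volume : Measure ℝ).prod volume))
      ((1 : ℝ), (0 : EuclideanSpace ℝ d)) = FunctionSpaces.Torus.stConv (deriv η) K F t (FunctionSpaces.Torus.proj y) := by
    rw [← (FunctionSpaces.Torus.hasFDerivAt_stLift_stConv hF hη hηc hK (t, y)).fderiv, FunctionSpaces.Torus.fderiv_stLift_stConv_apply hF hη hηc hK]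
    simp only [FunctionSpaces.Torus.lineDeriv_zero_right, FunctionSpaces.Torus.stConv_zero_kernel, one_mul]
    simp [FunctionSpaces.Torus.stLift]
  rw [hval] at h
  exact h

omit [DecidableEq d] in
/-- **The time-derivative pairing is an exact energy derivative** (the heart of step (11) of
CCFS 2008 with the doubly mollified test field): for one component `U` (integrable on `ℝ × T^d`)
and the test field `ψ = cetTest ρ K θ U` with even `ρ`, `K`,
`∫ U ∂ₜψ = ½ ∫ θ'(s) (∫ w̃(s,z)² dz) ds`, `w̃ = stConv ρ K U` (duality with the odd kernel `ρ'`,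
`stConv ρ' K U = ∂ₛw̃`, the chain rule and an integration by parts in time). [cite: CCFS2008, §3.2 (11)] -/
theorem integral_mul_timeDeriv_cetTest (hU : Integrable U ((volume : Measure ℝ).prod volume))
    (hρ : ContDiff ℝ ∞ ρ) (hρc : HasCompactSupport ρ) (hρeven : ∀ r, ρ (-r) = ρ r) (hK : FunctionSpaces.Torus.IsSmooth K)
    (hKeven : ∀ z, K (-z) = K z) (hθ : ContDiff ℝ ∞ θ) (hθc : HasCompactSupport θ) :
    ∫ q, U q * FunctionSpaces.Torus.timeDeriv (cetTest ρ K θ U) q.1 q.2 ∂((volume : Measure ℝ).prod volume) =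
      2⁻¹ * ∫ s, deriv θ s * ∫ z, FunctionSpaces.Torus.stConv ρ K U s z ^ 2 := by
  set μ : Measure (ℝ × UnitAddTorus d) := (volume : Measure ℝ).prod volume with hμ
  have hρ1 : ContDiff ℝ 1 ρ := hρ.of_le (by norm_cast)
  have hρ' : ContDiff ℝ ∞ (deriv ρ) := hρ.deriv'
  have hρ'1 : ContDiff ℝ 1 (deriv ρ) := hρ'.of_le (by norm_cast)
  have hK1 : FunctionSpaces.Torus.IsContDiff 1 K := hK.isContDiff (by simp)
  have hG : Integrable (fun p : ℝ × UnitAddTorus d => θ p.1 * FunctionSpaces.Torus.stConv ρ K U p.1 p.2) μ :=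
    integrable_cutoff_stConv hU hρ hρc hK hθ hθc
  -- (1) `∂ₜψ = stConv ρ' K G`
  have h1 : ∀ q : ℝ × UnitAddTorus d, FunctionSpaces.Torus.timeDeriv (cetTest ρ K θ U) q.1 q.2 =
      FunctionSpaces.Torus.stConv (deriv ρ) K (fun p => θ p.1 * FunctionSpaces.Torus.stConv ρ K U p.1 p.2) q.1 q.2 := fun q =>
    FunctionSpaces.Torus.timeDeriv_stConv hG hρ1 hρc hK1 q.1 q.2
  simp_rw [h1]
  -- (2) duality with the odd kernel `ρ'`
  rw [integral_mul_stConv_odd_even hU hG (hρ.continuous_deriv (by simp)) hρc.deriv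
    (FunctionSpaces.deriv_neg_of_even hρeven) hK.continuous hKeven]
  -- (3) `stConv ρ' K U = ∂ₛ w̃`; write the `p`-integral as an iterated integral
  set w : ℝ → UnitAddTorus d → ℝ := FunctionSpaces.Torus.stConv ρ K U with hw
  set w' : ℝ → UnitAddTorus d → ℝ := FunctionSpaces.Torus.stConv (deriv ρ) K U with hw'
  obtain ⟨M₀, hM₀⟩ := exists_abs_stConv_le hU hρ.continuous hρc hK.continuous
  obtain ⟨M₁, hM₁⟩ := exists_abs_stConv_le hU (hρ.continuous_deriv (by simp)) hρc.deriv hK.continuous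
  set M : ℝ := max M₀ M₁ with hM
  have hwM : ∀ s z, |w s z| ≤ M := fun s z => (hM₀ s z).trans (le_max_left _ _)
  have hw'M : ∀ s z, |w' s z| ≤ M := fun s z => (hM₁ s z).trans (le_max_right _ _)
  have hwc : Continuous (uncurry w) :=
    FunctionSpaces.Torus.continuous_uncurry_of_continuous_stLift (FunctionSpaces.Torus.contDiff_top_stLift_stConv hU hρ hρc hK).continuous
  have hw'c : Continuous (uncurry w') :=
    FunctionSpaces.Torus.continuous_uncurry_of_continuous_stLift (FunctionSpaces.Torus.contDiff_top_stLift_stConv hU hρ' hρc.deriv hK).continuous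
  -- the energy `φ(s) = ∫ w(s,z)² dz` and its derivative
  set φ : ℝ → ℝ := fun s => ∫ z, w s z ^ 2 with hφ
  have hφd : ∀ s, HasDerivAt φ (∫ z, 2 * w s z * w' s z) s := fun s =>
    FunctionSpaces.Torus.hasDerivAt_integral_sq (fun z s => hasDerivAt_stConv_time hU hρ1 hρc hK1 s z) hwM hw'M
      (fun s => (hwc.comp (Continuous.prodMk_right s)).aestronglyMeasurable)
      (fun s => (hw'c.comp (Continuous.prodMk_right s)).aestronglyMeasurable) s
  set D : ℝ → ℝ := fun s => ∫ z, 2 * w s z * w' s z with hD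
  -- continuity of `φ` and `D` (parametric integrals of jointly continuous integrands)
  have hφc : Continuous φ := by
    have hc : Continuous (uncurry fun s z => w s z ^ 2) := hwc.pow 2
    have := continuous_parametric_integral_of_continuous
      (μ := (volume : Measure (UnitAddTorus d))) hc isCompact_univ
    simpa only [Measure.restrict_univ] using this
  have hDc : Continuous D := by
    have hc : Continuous (uncurry fun s z => 2 * w s z * w' s z) :=
      (hwc.const_mul 2).mul hw'c
    have := continuous_parametric_integral_of_continuous
      (μ := (volume : Measure (UnitAddTorus d))) hc isCompact_univ
    simpa only [Measure.restrict_univ] using this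
  -- (3a) the `p`-integral as an iterated integral
  have hθi : Integrable (fun p : ℝ × UnitAddTorus d => θ p.1) μ := by
    have h1 : Integrable θ (volume : Measure ℝ) := hθ.continuous.integrable_of_hasCompactSupport hθc
    have := h1.mul_prod (f := θ) (g := fun _ : UnitAddTorus d => (1 : ℝ))
      (integrable_const (μ := (volume : Measure (UnitAddTorus d))) (1 : ℝ))
    simpa using this
  have hfi : Integrable (fun p : ℝ × UnitAddTorus d => θ p.1 * (w p.1 p.2 * w' p.1 p.2)) μ := by
    refine hθi.mul_bdd (c := M * M) ((hwc.mul hw'c).aestronglyMeasurable) (Eventually.of_forall fun p => ?_)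
    rw [norm_mul, Real.norm_eq_abs, Real.norm_eq_abs]
    exact mul_le_mul (hwM _ _) (hw'M _ _) (abs_nonneg _) ((abs_nonneg _).trans (hwM 0 0))
  have h3 : ∫ p, θ p.1 * FunctionSpaces.Torus.stConv ρ K U p.1 p.2 * FunctionSpaces.Torus.stConv (deriv ρ) K U p.1 p.2 ∂μ =
      ∫ s, θ s * (2⁻¹ * D s) := by
    have heq : (fun p : ℝ × UnitAddTorus d => θ p.1 * FunctionSpaces.Torus.stConv ρ K U p.1 p.2 * FunctionSpaces.Torus.stConv (deriv ρ) K U p.1 p.2) =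
        fun p => θ p.1 * (w p.1 p.2 * w' p.1 p.2) := by
      funext p
      simp only [hw, hw']
      ring
    rw [heq, integral_prod _ hfi]
    refine integral_congr_ae (Eventually.of_forall fun s => ?_)
    show ∫ z, θ s * (w s z * w' s z) = θ s * (2⁻¹ * D s)
    rw [integral_const_mul]
    congr 1
    have : (fun z => 2 * w s z * w' s z) = fun z => 2 * (w s z * w' s z) := funext fun z => by ring
    simp only [hD, this, integral_const_mul]
    ring
  -- (3b) integration by parts in time
  have hibp : ∫ s, θ s * D s = -∫ s, deriv θ s * φ s := by
    refine integral_mul_deriv_eq_deriv_mul_of_integrable (u := θ) (v := φ) (u' := deriv θ) (v' := D)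
      (fun x _ => ((hθ.differentiable (by simp)) x).hasDerivAt) (fun x _ => hφd x) ?_ ?_ ?_
    · exact (hθ.continuous.mul hDc).integrable_of_hasCompactSupport hθc.mul_right
    · exact ((hθ.continuous_deriv (by simp)).mul hφc).integrable_of_hasCompactSupport hθc.deriv.mul_right
    · exact (hθ.continuous.mul hφc).integrable_of_hasCompactSupport hθc.mul_right
  rw [h3]
  have h4 : ∫ s, θ s * (2⁻¹ * D s) = 2⁻¹ * ∫ s, θ s * D s := by
    rw [← integral_const_mul]
    refine integral_congr_ae (Eventually.of_forall fun s => ?_)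
    ring
  rw [h4, hibp]
  ring

omit [DecidableEq d] in
/-- A space–time mollification read slice-wise: `stConv ρ K U (s, ·) = (ρ ⋆ₜ w(·, y))(s)` with
`w = sliceConv U K`, as an identity of functions of `y`. [folklore] -/
theorem stConv_eq_timeConv_sliceConv (hU : Integrable U ((volume : Measure ℝ).prod volume))
    (hρ : Continuous ρ) (hρc : HasCompactSupport ρ) (hK : Continuous K) (s : ℝ) :
    FunctionSpaces.Torus.stConv ρ K U s = fun y => (ρ ⋆ fun r => sliceConv U K r y) s :=
  funext fun y => FunctionSpaces.Torus.stConv_eq_timeConv hU hρ hρc hK s y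

omit [DecidableEq d] in
/-- Integrability of the slice-wise mollification on `ℝ × T^d`. [folklore] -/
theorem integrable_uncurry_sliceConv (hUm : StronglyMeasurable U)
    (hU : Integrable U ((volume : Measure ℝ).prod volume)) (hK : Continuous K) :
    Integrable (uncurry (sliceConv U K)) ((volume : Measure ℝ).prod volume) := by
  refine ⟨(stronglyMeasurable_uncurry_sliceConv hUm hK).aestronglyMeasurable, ?_⟩
  have h := eLpNorm_uncurry_sliceConv_le hUm hK le_rfl ENNReal.one_ne_top
  rw [eLpNorm_one_eq_lintegral_enorm, eLpNorm_one_eq_lintegral_enorm] at h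
  exact lt_of_le_of_lt h (ENNReal.mul_lt_top hK.integrable_unitAddTorus.2 hU.2)

/-- **The space derivatives of the test field as iterated time mollifications**:
`∂ᵢψ(t, x) = (ρ ⋆ₜ (s ↦ θ(s) (ρ ⋆ₜ B(·, x))(s)))(t)` with `B(r, x) = (w(r, ·) ⋆ ∂ᵢK)(x)`,
`w = sliceConv U K`. [folklore] -/
theorem partialDeriv_cetTest_eq (hUm : StronglyMeasurable U)
    (hU : Integrable U ((volume : Measure ℝ).prod volume)) (hρ : ContDiff ℝ ∞ ρ)
    (hρc : HasCompactSupport ρ) (hK : FunctionSpaces.Torus.IsSmooth K) (hθ : ContDiff ℝ ∞ θ) (hθc : HasCompactSupport θ)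
    (i : d) (t : ℝ) (x : UnitAddTorus d) :
    FunctionSpaces.Torus.partialDeriv i (cetTest ρ K θ U t) x =
      (ρ ⋆ fun s => θ s * (ρ ⋆ fun r => ((sliceConv U K r) ⋆ FunctionSpaces.Torus.partialDeriv i K) x) s) t := by
  have hρ1 : ContDiff ℝ 1 ρ := hρ.of_le (by norm_cast)
  have hK1 : FunctionSpaces.Torus.IsContDiff 1 K := hK.isContDiff (by simp)
  have hG := integrable_cutoff_stConv hU hρ hρc hK hθ hθc
  have hdK : Continuous (FunctionSpaces.Torus.partialDeriv i K) := (hK.partialDeriv i).continuous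
  rw [cetTest, FunctionSpaces.Torus.partialDeriv_stConv hG hρ1 hρc hK1, FunctionSpaces.Torus.stConv_eq_timeConv hG hρ.continuous hρc hdK]
  congr 1
  funext s
  -- `(θ(s) w̃(s,·)) ⋆ ∂ᵢK = θ(s) ((ρ ⋆ₜ w(·,y))(s) ⋆ ∂ᵢK) = θ(s) (ρ ⋆ₜ (r ↦ (w(r,·) ⋆ ∂ᵢK)(x)))(s)`
  have hsm : ((fun z => θ s * FunctionSpaces.Torus.stConv ρ K U s z) ⋆ FunctionSpaces.Torus.partialDeriv i K) x =
      θ s * ((FunctionSpaces.Torus.stConv ρ K U s) ⋆ FunctionSpaces.Torus.partialDeriv i K) x := by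
    simp only [convolution_lsmul, smul_eq_mul, mul_assoc]
    exact integral_const_mul _ _
  rw [hsm, stConv_eq_timeConv_sliceConv hU hρ.continuous hρc hK.continuous s,
    ← FunctionSpaces.Torus.timeConv_spaceConv_comm (integrable_uncurry_sliceConv hUm hU hK.continuous) hρ.continuous hρc hdK]

end TestField

/-! ## Iterated time mollifications with a cut-off converge in `Lᵖ(ℝ × X)` -/

section IteratedTimeConv

variable {X : Type*} [MeasurableSpace X] {μ : Measure X} [SFinite μ]

/-- For `g` jointly measurable with `‖g‖_{Lᵖ(ℝ × X)} < ∞`, almost every fibre `g(·, x)` is in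
`Lᵖ(ℝ)` (Tonelli). [folklore] -/
theorem ae_eLpNorm_fibre_lt_top' {g : ℝ → X → ℝ} (hg : StronglyMeasurable (uncurry g))
    {p : ℝ≥0∞} (hp0 : p ≠ 0) (hp' : p ≠ ⊤)
    (hgp : eLpNorm (uncurry g) p ((volume : Measure ℝ).prod μ) < ⊤) :
    ∀ᵐ x ∂μ, eLpNorm (fun σ => g σ x) p volume < ⊤ := by
  have hpr : 0 < p.toReal := ENNReal.toReal_pos hp0 hp'
  have hm : Measurable fun x => ∫⁻ σ, ‖g σ x‖ₑ ^ p.toReal ∂volume :=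
    (hg.enorm.pow_const _).lintegral_prod_left'
  have htot : ∫⁻ x, ∫⁻ σ, ‖g σ x‖ₑ ^ p.toReal ∂volume ∂μ =
      eLpNorm (uncurry g) p ((volume : Measure ℝ).prod μ) ^ p.toReal := by
    rw [eLpNorm_eq_eLpNorm' hp0 hp', ← lintegral_rpow_enorm_eq_rpow_eLpNorm' hpr,
      lintegral_prod_symm _ (hg.aestronglyMeasurable.enorm.pow_const _)]
    rfl
  have hfin : ∫⁻ x, ∫⁻ σ, ‖g σ x‖ₑ ^ p.toReal ∂volume ∂μ ≠ ⊤ := by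
    rw [htot]; exact (ENNReal.rpow_lt_top_of_nonneg hpr.le hgp.ne).ne
  filter_upwards [ae_lt_top hm hfin] with x hx
  rw [eLpNorm_eq_eLpNorm' hp0 hp', eLpNorm'_eq_lintegral_enorm]
  exact ENNReal.rpow_lt_top_of_nonneg (by positivity) hx.ne

/-- A null set of fibres gives a null set of the product. [folklore] -/
theorem ae_prod_of_ae_fibre {P : ℝ × X → Prop} (h : ∀ᵐ x ∂μ, ∀ t, P (t, x)) :
    ∀ᵐ z ∂((volume : Measure ℝ).prod μ), P z := by
  rw [ae_iff] at h ⊢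
  have hsub : {z : ℝ × X | ¬P z} ⊆ (univ : Set ℝ) ×ˢ {x | ¬∀ t, P (t, x)} := fun z hz =>
    ⟨mem_univ _, fun hall => hz (hall z.1)⟩
  refine measure_mono_null hsub ?_
  rw [Measure.prod_prod, h, mul_zero]

/-- A continuous factor preserves local integrability on `ℝ`. [folklore] -/
theorem locallyIntegrable_continuous_mul {θ g : ℝ → ℝ} (hθ : Continuous θ)
    (hg : LocallyIntegrable g volume) : LocallyIntegrable (fun s => θ s * g s) volume := by
  rw [locallyIntegrable_iff] at hg ⊢
  exact fun K hK => (hg K hK).continuousOn_mul hθ.continuousOn hK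

/-- Pointwise linearity of time mollification against locally integrable fibres. [folklore] -/
theorem timeConv_sub_apply {ρ f g : ℝ → ℝ} (hρ : Continuous ρ) (hρc : HasCompactSupport ρ)
    (hf : LocallyIntegrable f volume) (hg : LocallyIntegrable g volume) (t : ℝ) :
    (ρ ⋆ fun s => f s - g s) t = (ρ ⋆ f) t - (ρ ⋆ g) t := by
  have h1 : ConvolutionExistsAt ρ f t (ContinuousLinearMap.lsmul ℝ ℝ) volume :=
    hρc.convolutionExists_left _ hρ hf t
  have h2 : ConvolutionExistsAt ρ g t (ContinuousLinearMap.lsmul ℝ ℝ) volume :=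
    hρc.convolutionExists_left _ hρ hg t
  simp only [convolution_lsmul, smul_eq_mul, mul_sub]
  exact integral_sub h1 h2

/-- **Iterated time mollification with an intermediate cut-off converges in `Lᵖ(ℝ × X)`**:
`‖ρᵢ ⋆ₜ (θ · (ρᵢ ⋆ₜ B)) - θ B‖_{Lᵖ(ℝ × X)} → 0` for `B ∈ Lᵖ(ℝ × X)` jointly measurable, `θ`
bounded continuous and normalised bumps `ρᵢ` with `rOut → 0` (Young's contraction
`Literature...TimeMollification.eLpNorm_timeConv_le` and the convergence
`tendsto_eLpNorm_timeConv_sub`, applied to `B` and to `θB`). [folklore] -/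
theorem tendsto_eLpNorm_iteratedTimeConv_sub {ι : Type*} {φ : ι → ContDiffBump (0 : ℝ)}
    {l : Filter ι} [l.IsCountablyGenerated] (hφ : Tendsto (fun i => (φ i).rOut) l (𝓝 0))
    {B : ℝ → X → ℝ} (hB : StronglyMeasurable (uncurry B)) {p : ℝ≥0∞} (hp : 1 ≤ p) (hp' : p ≠ ⊤)
    (hBp : eLpNorm (uncurry B) p ((volume : Measure ℝ).prod μ) < ⊤) {θ : ℝ → ℝ}
    (hθ : Continuous θ) {C : ℝ} (hC : ∀ s, |θ s| ≤ C) :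
    Tendsto (fun i => eLpNorm (fun z : ℝ × X =>
      ((φ i).normed volume ⋆ fun s => θ s * ((φ i).normed volume ⋆ fun r => B r z.2) s) z.1 -
        θ z.1 * B z.1 z.2) p ((volume : Measure ℝ).prod μ)) l (𝓝 0) := by
  have hp0 : p ≠ 0 := (zero_lt_one.trans_le hp).ne'
  have hC0 : 0 ≤ C := (abs_nonneg _).trans (hC 0)
  set ν : Measure (ℝ × X) := (volume : Measure ℝ).prod μ with hν
  -- the time mollification of `B` and the two cut-off fields
  set TB : ι → ℝ → X → ℝ := fun i s x => ((φ i).normed volume ⋆ fun r => B r x) s with hTB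
  have hTBm : ∀ i, StronglyMeasurable (uncurry (TB i)) := fun i => FunctionSpaces.stronglyMeasurable_timeConv (φ i) hB
  set f₂ : ℝ → X → ℝ := fun s x => θ s * B s x with hf₂
  set f₁ : ι → ℝ → X → ℝ := fun i s x => θ s * TB i s x with hf₁
  have hθm : StronglyMeasurable fun z : ℝ × X => θ z.1 :=
    (hθ.measurable.comp measurable_fst).stronglyMeasurable
  have hf₂m : StronglyMeasurable (uncurry f₂) := hθm.mul hB
  have hf₁m : ∀ i, StronglyMeasurable (uncurry (f₁ i)) := fun i => hθm.mul (hTBm i)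
  -- `Lᵖ` bounds
  have hcut : ∀ {g : ℝ → X → ℝ}, eLpNorm (uncurry fun s x => θ s * g s x) p ν ≤
      ENNReal.ofReal C * eLpNorm (uncurry g) p ν := fun {g} =>
    eLpNorm_le_mul_eLpNorm_of_ae_le_mul (Eventually.of_forall fun z => by
      simp only [uncurry, norm_mul, Real.norm_eq_abs]
      exact mul_le_mul_of_nonneg_right (hC _) (abs_nonneg _)) p
  have hf₂p : eLpNorm (uncurry f₂) p ν < ⊤ :=
    lt_of_le_of_lt hcut (ENNReal.mul_lt_top ENNReal.ofReal_lt_top hBp)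
  -- the two convergences from the tree
  have hconvB := FunctionSpaces.tendsto_eLpNorm_timeConv_sub (μ := μ) hφ hB hp hp' hBp
  have hconv₂ := FunctionSpaces.tendsto_eLpNorm_timeConv_sub (μ := μ) hφ hf₂m hp hp' hf₂p
  -- the split `A i + C i`
  set A : ι → ℝ × X → ℝ := fun i z =>
    ((φ i).normed volume ⋆ fun s => f₁ i s z.2) z.1 - ((φ i).normed volume ⋆ fun s => f₂ s z.2) z.1
    with hA
  set Cf : ι → ℝ × X → ℝ := fun i z =>
    ((φ i).normed volume ⋆ fun s => f₂ s z.2) z.1 - f₂ z.1 z.2 with hCf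
  have hsplit : ∀ i, (fun z : ℝ × X =>
      ((φ i).normed volume ⋆ fun s => θ s * ((φ i).normed volume ⋆ fun r => B r z.2) s) z.1 -
        θ z.1 * B z.1 z.2) = fun z => A i z + Cf i z := by
    intro i
    funext z
    simp only [hA, hCf, hf₁, hf₂, hTB]
    ring
  simp_rw [hsplit]
  have hAm : ∀ i, AEStronglyMeasurable (A i) ν := fun i =>
    ((FunctionSpaces.stronglyMeasurable_timeConv (φ i) (hf₁m i)).sub
      (FunctionSpaces.stronglyMeasurable_timeConv (φ i) hf₂m)).aestronglyMeasurable
  have hCm : ∀ i, AEStronglyMeasurable (Cf i) ν := fun i =>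
    ((FunctionSpaces.stronglyMeasurable_timeConv (φ i) hf₂m).sub hf₂m).aestronglyMeasurable
  -- bound for `A i`: a.e. it is the mollification of `θ (TB i - B)`
  have hAbound : ∀ i, eLpNorm (A i) p ν ≤
      ENNReal.ofReal C * eLpNorm (fun z : ℝ × X => TB i z.1 z.2 - B z.1 z.2) p ν := by
    intro i
    -- a.e. fibre in `Lᵖ`, hence locally integrable
    have hfib : ∀ᵐ x ∂μ, LocallyIntegrable (fun σ => B σ x) volume := by
      filter_upwards [ae_eLpNorm_fibre_lt_top' hB hp0 hp' hBp] with x hx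
      exact MemLp.locallyIntegrable ⟨(hB.of_uncurry_right).aestronglyMeasurable, hx⟩ hp
    have hae : A i =ᵐ[ν] fun z => ((φ i).normed volume ⋆ fun s => f₁ i s z.2 - f₂ s z.2) z.1 := by
      refine ae_prod_of_ae_fibre (hfib.mono fun x hx t => ?_)
      have hTBx : LocallyIntegrable (fun s => TB i s x) volume :=
        ((φ i).hasCompactSupport_normed.continuous_convolution_left _ (φ i).continuous_normed
          hx).locallyIntegrable
      simp only [hA, hf₁, hf₂]
      rw [timeConv_sub_apply (φ i).continuous_normed (φ i).hasCompactSupport_normed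
        (locallyIntegrable_continuous_mul hθ hTBx) (locallyIntegrable_continuous_mul hθ hx)]
    rw [eLpNorm_congr_ae hae]
    have hgm : StronglyMeasurable (uncurry fun s x => f₁ i s x - f₂ s x) := (hf₁m i).sub hf₂m
    refine (FunctionSpaces.eLpNorm_timeConv_le (μ := μ) (φ i) hgm hp hp').trans ?_
    have : (uncurry fun s x => f₁ i s x - f₂ s x) = uncurry fun s x => θ s * (TB i s x - B s x) := by
      funext z
      simp only [uncurry, hf₁, hf₂]
      ring
    rw [this]
    exact hcut
  -- conclude: `‖A i‖ + ‖C i‖ → 0`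
  have hA0 : Tendsto (fun i => eLpNorm (A i) p ν) l (𝓝 0) := by
    have h := ENNReal.Tendsto.const_mul hconvB (Or.inr ENNReal.ofReal_ne_top) (a := ENNReal.ofReal C)
    rw [mul_zero] at h
    exact tendsto_of_tendsto_of_tendsto_of_le_of_le tendsto_const_nhds h (fun i => bot_le) hAbound
  have hsum : Tendsto (fun i => eLpNorm (A i) p ν + eLpNorm (Cf i) p ν) l (𝓝 0) := by
    have := hA0.add hconv₂
    rwa [add_zero] at this
  refine tendsto_of_tendsto_of_tendsto_of_le_of_le tendsto_const_nhds hsum (fun i => bot_le) fun i => ?_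
  exact eLpNorm_add_le (hAm i) (hCm i) hp

end IteratedTimeConv

/-! ## Pairings against `Lᵖ`-convergent sequences -/

section Pairing

variable {α : Type*} [MeasurableSpace α] {μ : Measure α}

/-- Hölder `(3/2, 3)` for the integral of a product of real functions:
`‖∫ f g‖ₑ ≤ ‖f‖_{3/2} ‖g‖₃`. [folklore] -/
theorem enorm_integral_mul_le_threeHalves_three {f g : α → ℝ} (hf : AEStronglyMeasurable f μ)
    (hg : AEStronglyMeasurable g μ) :
    ‖∫ x, f x * g x ∂μ‖ₑ ≤ eLpNorm f (3 / 2) μ * eLpNorm g 3 μ := by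
  haveI := FunctionSpaces.holderTriple_threeHalves_three
  refine (enorm_integral_le_lintegral_enorm _).trans ?_
  have h := eLpNorm_smul_le_mul_eLpNorm (p := 3 / 2) (q := 3) (r := 1) hg hf
  rw [eLpNorm_one_eq_lintegral_enorm] at h
  refine le_trans (le_of_eq (lintegral_congr fun x => ?_)) h
  rw [Pi.smul_apply', smul_eq_mul, enorm_mul]

/-- **Pairings converge along `L³` convergence**: if `gᵢ → g₀` in `L³` and `f ∈ L^{3/2}`, then
`∫ f gᵢ → ∫ f g₀`. [folklore] -/
theorem tendsto_integral_mul_of_tendsto_eLpNorm_three {ι : Type*} {l : Filter ι} {f : α → ℝ}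
    {g : ι → α → ℝ} {g₀ : α → ℝ} (hf : MemLp f (3 / 2) μ) (hg : ∀ i, AEStronglyMeasurable (g i) μ)
    (hg₀ : MemLp g₀ 3 μ) (h : Tendsto (fun i => eLpNorm (fun x => g i x - g₀ x) 3 μ) l (𝓝 0)) :
    Tendsto (fun i => ∫ x, f x * g i x ∂μ) l (𝓝 (∫ x, f x * g₀ x ∂μ)) := by
  haveI := FunctionSpaces.holderTriple_threeHalves_three
  have hfg₀ : Integrable (fun x => f x * g₀ x) μ := hf.integrable_mul hg₀
  -- the bound `‖∫ f gᵢ - ∫ f g₀‖ ≤ (‖f‖_{3/2} ‖gᵢ - g₀‖₃).toReal` eventually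
  have hb : Tendsto (fun i => (eLpNorm f (3 / 2) μ * eLpNorm (fun x => g i x - g₀ x) 3 μ).toReal)
      l (𝓝 0) := by
    have h1 := ENNReal.Tendsto.const_mul h (Or.inr hf.eLpNorm_ne_top) (a := eLpNorm f (3 / 2) μ)
    rw [mul_zero] at h1
    have h2 := (ENNReal.tendsto_toReal ENNReal.zero_ne_top).comp h1
    rwa [ENNReal.toReal_zero] at h2
  rw [tendsto_iff_norm_sub_tendsto_zero]
  refine squeeze_zero' (Eventually.of_forall fun i => norm_nonneg _) ?_ hb
  filter_upwards [h.eventually (Iio_mem_nhds ENNReal.zero_lt_top)] with i hi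
  have hdiff : MemLp (fun x => g i x - g₀ x) 3 μ := ⟨(hg i).sub hg₀.aestronglyMeasurable, hi⟩
  have hfd : Integrable (fun x => f x * (g i x - g₀ x)) μ := hf.integrable_mul hdiff
  have hfgi : Integrable (fun x => f x * g i x) μ := by
    have := hfd.add hfg₀
    refine this.congr (Eventually.of_forall fun x => ?_)
    simp only [Pi.add_apply]
    ring
  rw [← integral_sub hfgi hfg₀]
  have heq : (fun x => f x * g i x - f x * g₀ x) = fun x => f x * (g i x - g₀ x) := by
    funext x; ring
  rw [heq]
  have hfin : eLpNorm f (3 / 2) μ * eLpNorm (fun x => g i x - g₀ x) 3 μ ≠ ⊤ :=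
    ENNReal.mul_ne_top hf.eLpNorm_ne_top hi.ne
  have := enorm_integral_mul_le_threeHalves_three hf.aestronglyMeasurable hdiff.aestronglyMeasurable
    (μ := μ)
  rw [← ofReal_norm] at this
  exact (ENNReal.ofReal_le_iff_le_toReal hfin).1 this

/-- Hölder `(2, 2)` for three real factors with a bounded first factor:
`‖∫ a f g‖ₑ ≤ C ‖f‖₂ ‖g‖₂` when `|a| ≤ C`. [folklore] -/
theorem enorm_integral_mul_mul_le_two_two {a f g : α → ℝ} {C : ℝ} (ha : ∀ x, |a x| ≤ C)
    (hf : AEStronglyMeasurable f μ) (hg : AEStronglyMeasurable g μ) :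
    ‖∫ x, a x * f x * g x ∂μ‖ₑ ≤ ENNReal.ofReal C * eLpNorm f 2 μ * eLpNorm g 2 μ := by
  refine (enorm_integral_le_lintegral_enorm _).trans ?_
  have h := eLpNorm_smul_le_mul_eLpNorm (p := 2) (q := 2) (r := 1) hg hf
  rw [eLpNorm_one_eq_lintegral_enorm] at h
  calc ∫⁻ x, ‖a x * f x * g x‖ₑ ∂μ ≤ ∫⁻ x, ENNReal.ofReal C * ‖(f • g) x‖ₑ ∂μ := by
        refine lintegral_mono fun x => ?_
        rw [Pi.smul_apply', smul_eq_mul, mul_assoc, enorm_mul, Real.enorm_eq_ofReal_abs]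
        exact mul_le_mul_left (ENNReal.ofReal_le_ofReal (ha x)) _
    _ = ENNReal.ofReal C * ∫⁻ x, ‖(f • g) x‖ₑ ∂μ := lintegral_const_mul' _ _ ENNReal.ofReal_ne_top
    _ ≤ ENNReal.ofReal C * (eLpNorm f 2 μ * eLpNorm g 2 μ) := mul_le_mul_right h _
    _ = _ := by ring

end Pairing

/-! ## The mollified energies converge (time mollification, `L²`) -/

section EnergyLimit

variable {X : Type*} [MeasurableSpace X] {μ : Measure X} [SFinite μ]

/-- **Cut-off square integrals converge along time mollification**: for `w ∈ L²(ℝ × X)` jointly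
measurable, `θ` bounded continuous and normalised bumps `ρᵢ` with `rOut → 0`,
`∫ θ(s) (ρᵢ ⋆ₜ w)(s, x)² → ∫ θ(s) w(s, x)²` (integrals over `ℝ × X`;
`w̃² - w² = (w̃ - w)(w̃ + w)`, Hölder and `‖w̃ - w‖₂ → 0`). [folklore] -/
theorem tendsto_integral_cutoff_sq_timeConv {ι : Type*} {φ : ι → ContDiffBump (0 : ℝ)}
    {l : Filter ι} [l.IsCountablyGenerated] (hφ : Tendsto (fun i => (φ i).rOut) l (𝓝 0))
    {w : ℝ → X → ℝ} (hw : StronglyMeasurable (uncurry w))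
    (hw2 : eLpNorm (uncurry w) 2 ((volume : Measure ℝ).prod μ) < ⊤) {θ : ℝ → ℝ}
    (hθ : Continuous θ) {C : ℝ} (hC : ∀ s, |θ s| ≤ C) :
    Tendsto (fun i => ∫ z, θ z.1 * (((φ i).normed volume ⋆ fun r => w r z.2) z.1) ^ 2
        ∂((volume : Measure ℝ).prod μ)) l
      (𝓝 (∫ z, θ z.1 * (w z.1 z.2) ^ 2 ∂((volume : Measure ℝ).prod μ))) := by
  set ν : Measure (ℝ × X) := (volume : Measure ℝ).prod μ with hν
  set W : ι → ℝ × X → ℝ := fun i z => ((φ i).normed volume ⋆ fun r => w r z.2) z.1 with hW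
  have hWm : ∀ i, StronglyMeasurable (W i) := fun i => FunctionSpaces.stronglyMeasurable_timeConv (φ i) hw
  have hw' : MemLp (uncurry w) 2 ν := ⟨hw.aestronglyMeasurable, hw2⟩
  have hWle : ∀ i, eLpNorm (W i) 2 ν ≤ eLpNorm (uncurry w) 2 ν := fun i =>
    FunctionSpaces.eLpNorm_timeConv_le (μ := μ) (φ i) hw one_le_two ENNReal.ofNat_ne_top
  have hW' : ∀ i, MemLp (W i) 2 ν := fun i => ⟨(hWm i).aestronglyMeasurable, (hWle i).trans_lt hw2⟩
  have hconv := FunctionSpaces.tendsto_eLpNorm_timeConv_sub (μ := μ) hφ hw one_le_two ENNReal.ofNat_ne_top hw2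
  -- integrability of the cut-off squares
  have hθm : AEStronglyMeasurable (fun z : ℝ × X => θ z.1) ν :=
    (hθ.measurable.comp measurable_fst).aestronglyMeasurable
  have hint : ∀ {g : ℝ × X → ℝ}, MemLp g 2 ν → Integrable (fun z => θ z.1 * g z ^ 2) ν := by
    intro g hg
    have h2 : Integrable (fun z => g z ^ 2) ν := by
      have := hg.integrable_mul hg
      refine this.congr (Eventually.of_forall fun z => ?_)
      simp only [Pi.mul_apply, sq]
    exact h2.bdd_mul hθm (Eventually.of_forall fun z => by rw [Real.norm_eq_abs]; exact hC _)
  rw [tendsto_iff_norm_sub_tendsto_zero]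
  have hb : Tendsto (fun i => (ENNReal.ofReal C * eLpNorm (fun z => W i z - uncurry w z) 2 ν *
      (2 * eLpNorm (uncurry w) 2 ν)).toReal) l (𝓝 0) := by
    have h1 : Tendsto (fun i => ENNReal.ofReal C * eLpNorm (fun z => W i z - uncurry w z) 2 ν *
        (2 * eLpNorm (uncurry w) 2 ν)) l (𝓝 0) := by
      have h := ENNReal.Tendsto.const_mul hconv (Or.inr ENNReal.ofReal_ne_top) (a := ENNReal.ofReal C)
      rw [mul_zero] at h
      have h' := ENNReal.Tendsto.mul_const h (Or.inr (ENNReal.mul_ne_top ENNReal.ofNat_ne_top hw2.ne))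
        (b := 2 * eLpNorm (uncurry w) 2 ν)
      rwa [zero_mul] at h'
    have h2 := (ENNReal.tendsto_toReal ENNReal.zero_ne_top).comp h1
    rwa [ENNReal.toReal_zero] at h2
  refine squeeze_zero' (Eventually.of_forall fun i => norm_nonneg _) ?_ hb
  refine Eventually.of_forall fun i => ?_
  show ‖(∫ z, θ z.1 * W i z ^ 2 ∂ν) - ∫ z, θ z.1 * uncurry w z ^ 2 ∂ν‖ ≤ _
  rw [← integral_sub (hint (hW' i)) (hint hw')]
  have heq : (fun z : ℝ × X => θ z.1 * W i z ^ 2 - θ z.1 * uncurry w z ^ 2) =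
      fun z => θ z.1 * (W i z - uncurry w z) * (W i z + uncurry w z) := by
    funext z
    simp only [uncurry]
    ring
  rw [heq]
  have hfin : ENNReal.ofReal C * eLpNorm (fun z => W i z - uncurry w z) 2 ν *
      (2 * eLpNorm (uncurry w) 2 ν) ≠ ⊤ :=
    ENNReal.mul_ne_top (ENNReal.mul_ne_top ENNReal.ofReal_ne_top ((hW' i).sub hw').eLpNorm_ne_top)
      (ENNReal.mul_ne_top ENNReal.ofNat_ne_top hw2.ne)
  refine (ENNReal.ofReal_le_iff_le_toReal hfin).1 ?_
  rw [ofReal_norm]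
  refine (enorm_integral_mul_mul_le_two_two (fun z => hC z.1) ((hW' i).sub hw').aestronglyMeasurable
    ((hW' i).add hw').aestronglyMeasurable).trans ?_
  refine mul_le_mul_right ?_ _
  calc eLpNorm (W i + uncurry w) 2 ν ≤ eLpNorm (W i) 2 ν + eLpNorm (uncurry w) 2 ν :=
        eLpNorm_add_le (hW' i).aestronglyMeasurable hw'.aestronglyMeasurable one_le_two
    _ ≤ eLpNorm (uncurry w) 2 ν + eLpNorm (uncurry w) 2 ν := add_le_add (hWle i) le_rfl
    _ = 2 * eLpNorm (uncurry w) 2 ν := by rw [two_mul]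

end EnergyLimit

/-! ## Vector test fields from real components: time derivative and convective pairing -/

section VecField

variable [DecidableEq d]

/-- A vector field on `ℝ × T^d` assembled from real components. [folklore] -/
def vecField (ψc : d → ℝ → UnitAddTorus d → ℝ) : ℝ → UnitAddTorus d → EuclideanSpace ℝ d :=
  fun t x => WithLp.toLp 2 fun j => ψc j t x

variable {ψc : d → ℝ → UnitAddTorus d → ℝ}

omit [Fintype d] [DecidableEq d] in
/-- Components of `vecField`. [folklore] -/
@[simp]
theorem vecField_apply (ψc : d → ℝ → UnitAddTorus d → ℝ) (t : ℝ) (x : UnitAddTorus d) (j : d) :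
    vecField ψc t x j = ψc j t x := rfl

omit [DecidableEq d] in
/-- **Time derivative componentwise**: `(∂ₜ ψ)ⱼ = ∂ₜ ψⱼ` when the components are differentiable in
time. [folklore] -/
theorem timeDeriv_vecField_apply {t : ℝ} {x : UnitAddTorus d}
    (h : ∀ j, DifferentiableAt ℝ (fun τ => ψc j τ x) t) (j : d) :
    FunctionSpaces.Torus.timeDeriv (vecField ψc) t x j = FunctionSpaces.Torus.timeDeriv (ψc j) t x := by
  set Φ : ℝ → EuclideanSpace ℝ d := fun τ => vecField ψc τ x with hΦ
  have hΦd : DifferentiableAt ℝ Φ t := (differentiableAt_piLp (𝕜 := ℝ) (p := 2)).2 h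
  have hcomp := ((PiLp.hasFDerivAt_apply (𝕜 := ℝ) 2 (Φ t) j).comp_hasDerivAt t hΦd.hasDerivAt).deriv
  -- `deriv (fun τ => Φ τ j) t = (deriv Φ t) j`
  simp only [FunctionSpaces.Torus.timeDeriv]
  change (deriv Φ t) j = deriv ((fun f : EuclideanSpace ℝ d => f j) ∘ Φ) t
  rw [hcomp]
  rfl

omit [DecidableEq d] in
/-- The pairing with the time derivative, componentwise: `⟪v, ∂ₜψ⟫ = ∑ⱼ vⱼ ∂ₜψⱼ`. [folklore] -/
theorem inner_timeDeriv_vecField {t : ℝ} {x : UnitAddTorus d}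
    (h : ∀ j, DifferentiableAt ℝ (fun τ => ψc j τ x) t) (v : EuclideanSpace ℝ d) :
    ⟪v, FunctionSpaces.Torus.timeDeriv (vecField ψc) t x⟫_ℝ = ∑ j, v j * FunctionSpaces.Torus.timeDeriv (ψc j) t x := by
  rw [PiLp.inner_apply]
  refine Finset.sum_congr rfl fun j _ => ?_
  rw [timeDeriv_vecField_apply h j]
  simp [mul_comm]

omit [DecidableEq d] in
/-- **Torus derivative componentwise**: `(Dψ(x) h)ⱼ = Dψⱼ(x) h` for `C¹` components. [folklore] -/
theorem fderiv_vecField_apply {t : ℝ} (hs : ∀ j, FunctionSpaces.Torus.IsContDiff 1 (ψc j t)) (x : UnitAddTorus d)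
    (h : EuclideanSpace ℝ d) (j : d) :
    FunctionSpaces.Torus.fderiv (vecField ψc t) x h j = FunctionSpaces.Torus.fderiv (ψc j t) x h := by
  set Φ : EuclideanSpace ℝ d → EuclideanSpace ℝ d := FunctionSpaces.Torus.liftAt (vecField ψc t) x with hΦ
  have hcompj : ∀ j, (fun v => Φ v j) = FunctionSpaces.Torus.liftAt (ψc j t) x := fun j => by
    funext v
    simp [hΦ, FunctionSpaces.Torus.liftAt_apply, vecField]
  have hΦd : DifferentiableAt ℝ Φ 0 := by
    refine (differentiableAt_piLp (𝕜 := ℝ) (p := 2)).2 fun j => ?_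
    rw [hcompj j]
    exact ((hs j).liftAt x).differentiable one_ne_zero |>.differentiableAt
  have hcomp := ((PiLp.hasFDerivAt_apply (𝕜 := ℝ) 2 (Φ 0) j).comp 0 hΦd.hasFDerivAt).fderiv
  simp only [FunctionSpaces.Torus.fderiv]
  change _ = _root_.fderiv ℝ (FunctionSpaces.Torus.liftAt (ψc j t) x) 0 h
  rw [← hcompj j]
  change _ = _root_.fderiv ℝ ((fun f : EuclideanSpace ℝ d => f j) ∘ Φ) 0 h
  rw [hcomp]
  rfl

/-- **The convective pairing componentwise**: `⟪v, (v·∇)ψ⟫ = ∑ⱼ vⱼ ∑ᵢ vᵢ ∂ᵢψⱼ` for `C¹`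
components. [folklore] -/
theorem inner_convect_vecField {t : ℝ} (hs : ∀ j, FunctionSpaces.Torus.IsContDiff 1 (ψc j t))
    (v : UnitAddTorus d → EuclideanSpace ℝ d) (x : UnitAddTorus d) :
    ⟪v x, FunctionSpaces.Torus.convect v (vecField ψc t) x⟫_ℝ = ∑ j, v x j * ∑ i, v x i * FunctionSpaces.Torus.partialDeriv i (ψc j t) x := by
  rw [PiLp.inner_apply]
  refine Finset.sum_congr rfl fun j _ => ?_
  rw [FunctionSpaces.Torus.convect, fderiv_vecField_apply hs, FunctionSpaces.Torus.fderiv_apply_eq_sum_partialDeriv (hs j)]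
  simp [smul_eq_mul, mul_comm]

end VecField

/-! ## Bump kernels in time -/

section Bumps

omit [Fintype d]

/-- A sequence of bump functions on `ℝ` centred at `0` with outer radii `< δ₀` and `→ 0`. [folklore] -/
theorem exists_contDiffBump_seq_lt {δ₀ : ℝ} (hδ₀ : 0 < δ₀) :
    ∃ φ : ℕ → ContDiffBump (0 : ℝ), (∀ n, (φ n).rOut < δ₀) ∧
      Tendsto (fun n => (φ n).rOut) atTop (𝓝 0) := by
  refine ⟨fun n => ⟨δ₀ / (n + 2) / 2, δ₀ / (n + 2), by positivity, by
    have : 0 < δ₀ / (n + 2) := by positivity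
    linarith⟩, fun n => ?_, ?_⟩
  · show δ₀ / (n + 2) < δ₀
    rw [div_lt_iff₀ (by positivity)]
    nlinarith
  · show Tendsto (fun n : ℕ => δ₀ / ((n : ℝ) + 2)) atTop (𝓝 0)
    have h := tendsto_const_div_atTop_nhds_zero_nat δ₀
    have h2 : Tendsto (fun n : ℕ => δ₀ / ((n + 2 : ℕ) : ℝ)) atTop (𝓝 0) :=
      h.comp (tendsto_add_atTop_nat 2)
    refine h2.congr fun n => ?_
    push_cast
    ring_nf

variable (φ : ContDiffBump (0 : ℝ))

/-- The normalised bump is smooth. [folklore] -/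
theorem contDiff_normed' : ContDiff ℝ ∞ (φ.normed volume) := φ.contDiff_normed

/-- The normalised bump is even. [folklore] -/
theorem normed_neg' (r : ℝ) : φ.normed volume (-r) = φ.normed volume r := φ.normed_neg r

/-- Where the normalised bump does not vanish, `|r| < rOut`. [folklore] -/
theorem abs_lt_of_normed_ne_zero {r : ℝ} (h : φ.normed volume r ≠ 0) : |r| < φ.rOut := by
  have : r ∈ Function.support (φ.normed volume) := h
  rw [φ.support_normed_eq, Metric.mem_ball, dist_zero_right, Real.norm_eq_abs] at this
  exact this

end Bumps

/-! ## The velocity extended by zero in time, as a field on `ℝ × T^d` -/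

section Bar

/-- The space–time field `u` on `(0,T) × T^d`, extended by zero to `ℝ × T^d`. [folklore] -/
def stBar (T : ℝ) (u : ℝ → UnitAddTorus d → EuclideanSpace ℝ d) :
    ℝ × UnitAddTorus d → EuclideanSpace ℝ d :=
  (Ioo 0 T ×ˢ (univ : Set (UnitAddTorus d))).indicator (uncurry u)

variable {T : ℝ} {u : ℝ → UnitAddTorus d → EuclideanSpace ℝ d}

omit [Fintype d] in
/-- On `(0,T)` the extension agrees with the field. [folklore] -/
theorem stBar_apply_of_mem [Fintype d] {t : ℝ} (ht : t ∈ Ioo 0 T) (x : UnitAddTorus d) :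
    stBar T u (t, x) = u t x := by
  simp [stBar, indicator_of_mem (show (t, x) ∈ Ioo 0 T ×ˢ (univ : Set (UnitAddTorus d)) from
    ⟨ht, mem_univ _⟩)]

omit [Fintype d] in
/-- Off `(0,T)` the extension vanishes. [folklore] -/
theorem stBar_apply_of_not_mem [Fintype d] {t : ℝ} (ht : t ∉ Ioo 0 T) (x : UnitAddTorus d) :
    stBar T u (t, x) = 0 := by
  simp [stBar, indicator_of_notMem (show (t, x) ∉ Ioo 0 T ×ˢ (univ : Set (UnitAddTorus d)) from
    fun h => ht h.1)]

/-- **The extended field is in `Lᵖ(ℝ × T^d)`** as soon as `∫₀ᵀ ∫ ‖u‖^p < ∞` (`p = 2, 3`),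
given joint measurability. [folklore] -/
theorem memLp_stBar (hm : AEStronglyMeasurable (uncurry u) ((volume.restrict (Ioo 0 T)).prod volume))
    {n : ℕ} (hn : n ≠ 0) (hfin : ∫⁻ t in Ioo 0 T, ∫⁻ x, ‖u t x‖ₑ ^ n < ⊤) :
    MemLp (stBar T u) (n : ℝ≥0∞) ((volume : Measure ℝ).prod volume) := by
  rw [stBar, memLp_indicator_iff_restrict (measurableSet_Ioo.prod MeasurableSet.univ),
    ← Measure.restrict_prod_eq_prod_univ]
  refine ⟨hm, ?_⟩
  have hn0 : (n : ℝ≥0∞) ≠ 0 := by exact_mod_cast hn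
  rw [eLpNorm_eq_lintegral_rpow_enorm_toReal hn0 (ENNReal.natCast_ne_top n)]
  refine ENNReal.rpow_lt_top_of_nonneg (by positivity) (ne_of_lt ?_)
  simp only [ENNReal.toReal_natCast, ENNReal.rpow_natCast]
  rw [lintegral_prod _ (hm.aemeasurable.enorm.pow_const _)]
  exact hfin

/-- The extended field is integrable on `ℝ × T^d` (finite measure of `(0,T) × T^d`). [folklore] -/
theorem integrable_stBar (hm : AEStronglyMeasurable (uncurry u) ((volume.restrict (Ioo 0 T)).prod volume))
    (h2 : ∫⁻ t in Ioo 0 T, ∫⁻ x, ‖u t x‖ₑ ^ 2 < ⊤) :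
    Integrable (stBar T u) ((volume : Measure ℝ).prod volume) := by
  have h := memLp_stBar hm two_ne_zero h2
  rw [stBar, memLp_indicator_iff_restrict (measurableSet_Ioo.prod MeasurableSet.univ),
    ← Measure.restrict_prod_eq_prod_univ] at h
  rw [stBar, integrable_indicator_iff (measurableSet_Ioo.prod MeasurableSet.univ), IntegrableOn,
    ← Measure.restrict_prod_eq_prod_univ]
  haveI : IsFiniteMeasure ((volume.restrict (Ioo (0 : ℝ) T)).prod (volume : Measure (UnitAddTorus d))) :=
    inferInstance
  exact h.integrable (by norm_num)

end Bar

/-! ## F1 assembly: identifications of the two limits -/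

section Identify

variable [DecidableEq d] {T : ℝ} {u : ℝ → UnitAddTorus d → EuclideanSpace ℝ d}
  {Uc : d → ℝ × UnitAddTorus d → ℝ} {K : UnitAddTorus d → ℝ} {θ : ℝ → ℝ}

omit [DecidableEq d] in
/-- Slices of the strongly measurable components agree a.e. with the slices of the field. [folklore] -/
theorem ae_slice_eq_of_ae_eq_stBar
    (hUc : ∀ j, Uc j =ᵐ[(volume : Measure ℝ).prod volume] fun q => stBar T u q j) :
    ∀ᵐ t ∂(volume : Measure ℝ), ∀ j, (fun y => Uc j (t, y)) =ᵐ[volume] fun y => stBar T u (t, y) j := by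
  have h : ∀ j, ∀ᵐ t ∂(volume : Measure ℝ), (fun y => Uc j (t, y)) =ᵐ[volume]
      fun y => stBar T u (t, y) j := fun j => Measure.ae_ae_of_ae_prod (hUc j)
  exact ae_all_iff.2 h

omit [DecidableEq d] in
/-- The kinetic energy of a mollified field through its components:
`E(v ⋆ K) = ½ ∑ⱼ ∫ ((vⱼ ⋆ K)(z))² dz` for `v ∈ L¹`, `K` continuous. [folklore] -/
theorem kineticEnergy_vecConv_eq_sum {v : UnitAddTorus d → EuclideanSpace ℝ d}
    (hv : Integrable v volume) (hK : Continuous K) :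
    FunctionSpaces.Torus.kineticEnergy (vecConv v K) = 2⁻¹ * ∑ j, ∫ z, (((fun y => v y j) ⋆ K) z) ^ 2 := by
  unfold FunctionSpaces.Torus.kineticEnergy
  congr 1
  have hc : ∀ j, Continuous ((fun y => v y j) ⋆ K) := fun j =>
    FunctionSpaces.Torus.continuous_convolution ((EuclideanSpace.proj (𝕜 := ℝ) j).integrable_comp hv) hK
  have hint : ∀ j, Integrable (fun z => (((fun y => v y j) ⋆ K) z) ^ 2) volume := fun j =>
    ((hc j).pow 2).integrable_unitAddTorus
  rw [← integral_finsetSum _ fun j _ => hint j]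
  refine integral_congr_ae (Eventually.of_forall fun z => ?_)
  show ‖vecConv v K z‖ ^ 2 = ∑ j, (((fun y => v y j) ⋆ K) z) ^ 2
  rw [EuclideanSpace.norm_sq_eq]
  refine Finset.sum_congr rfl fun j _ => ?_
  rw [Real.norm_eq_abs, sq_abs]
  rfl

omit [DecidableEq d] in
/-- **Identification of the energy limit**: with `wⱼ = sliceConv Uⱼ K` and `Uⱼ` a.e. equal to
the components of the extended field,
`∫ θ'(s) ½∑ⱼ ∫ wⱼ(s,z)² dz ds = ∫_{(0,T)} θ'(s) E(u(s) ⋆ K) ds`. [folklore] -/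
theorem integral_deriv_mul_sum_sq_sliceConv_eq (hθT : tsupport θ ⊆ Ioo 0 T)
    (hUc : ∀ j, Uc j =ᵐ[(volume : Measure ℝ).prod volume] fun q => stBar T u q j)
    (hL1 : ∀ᵐ t ∂(volume.restrict (Ioo 0 T)), Integrable (u t) volume) (hK : Continuous K) :
    ∫ s, deriv θ s * (2⁻¹ * ∑ j, ∫ z, (sliceConv (Uc j) K s z) ^ 2) =
      ∫ s in Ioo 0 T, deriv θ s * FunctionSpaces.Torus.kineticEnergy (vecConv (u s) K) := by
  rw [← integral_indicator measurableSet_Ioo]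
  refine integral_congr_ae ?_
  have hL1' : ∀ᵐ t ∂(volume : Measure ℝ), t ∈ Ioo 0 T → Integrable (u t) volume :=
    (ae_restrict_iff' measurableSet_Ioo).1 hL1
  filter_upwards [ae_slice_eq_of_ae_eq_stBar hUc, hL1'] with s hs hsL1
  by_cases hmem : s ∈ Ioo 0 T
  · rw [indicator_of_mem hmem, kineticEnergy_vecConv_eq_sum (hsL1 hmem) hK]
    congr 2
    refine Finset.sum_congr rfl fun j _ => ?_
    have hslice : (fun y => Uc j (s, y)) =ᵐ[volume] fun y => u s y j := by
      filter_upwards [hs j] with y hy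
      rw [hy, stBar_apply_of_mem hmem]
    show ∫ z, (((fun z' => Uc j (s, z')) ⋆ K) z) ^ 2 = ∫ z, (((fun y => u s y j) ⋆ K) z) ^ 2
    rw [FunctionSpaces.Torus.convolution_congr_ae_left (ContinuousLinearMap.lsmul ℝ ℝ) hslice]
  · rw [indicator_of_notMem hmem, deriv_of_notMem_tsupport fun h => hmem (hθT h),
      zero_mul]

/-- **The flux through its slices** (for one time slice `v ∈ L³`):
`∑ⱼᵢ ∫ vⱼ vᵢ ((vⱼ ⋆ K) ⋆ ∂ᵢK) = Π_K[v]` — move `∂ᵢ` across the outer mollification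
(`Torus.convolution_partialDeriv_right`) and the even kernel `K` onto `vⱼvᵢ`
(`Torus.integral_mul_convolution_comm`). [folklore] -/
theorem sum_integral_mul_sliceB_eq_cetFlux {v : UnitAddTorus d → EuclideanSpace ℝ d}
    (hv : MemLp v 3 volume) {ε : ℝ} (hε : 0 < ε) (hε' : ε ≤ 1 / 4) :
    ∑ j, ∑ i, ∫ x, v x j * v x i *
        (((fun y => v y j) ⋆ FunctionSpaces.Torus.kernel ε) ⋆ FunctionSpaces.Torus.partialDeriv i (FunctionSpaces.Torus.kernel ε)) x = cetFlux (FunctionSpaces.Torus.kernel ε) v := by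
  have hKs : FunctionSpaces.Torus.IsSmooth (FunctionSpaces.Torus.kernel (d := d) ε) := FunctionSpaces.Torus.isSmooth_kernel hε hε'
  have hKc : Continuous (FunctionSpaces.Torus.kernel (d := d) ε) := hKs.continuous
  have hv1 : Integrable v volume := hv.integrable (by norm_num)
  have hvj : ∀ j, Integrable (fun y => v y j) volume := fun j =>
    (EuclideanSpace.proj (𝕜 := ℝ) j).integrable_comp hv1
  have hvj2 : ∀ j, MemLp (fun y => v y j) 2 volume := fun j =>
    ((EuclideanSpace.proj (𝕜 := ℝ) j).comp_memLp' hv).mono_exponent (by norm_num)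
  have hw : ∀ j, FunctionSpaces.Torus.IsSmooth ((fun y => v y j) ⋆ FunctionSpaces.Torus.kernel ε) := fun j => FunctionSpaces.Torus.isSmooth_convolution (hvj j) hKs
  -- per pair `(j, i)`
  have hpair : ∀ j i, ∫ x, v x j * v x i * (((fun y => v y j) ⋆ FunctionSpaces.Torus.kernel ε) ⋆ FunctionSpaces.Torus.partialDeriv i (FunctionSpaces.Torus.kernel ε)) x =
      ∫ x, ((fun y => v y i * v y j) ⋆ FunctionSpaces.Torus.kernel ε) x * FunctionSpaces.Torus.partialDeriv i ((fun y => v y j) ⋆ FunctionSpaces.Torus.kernel ε) x := by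
    intro j i
    have h1 : ((fun y => v y j) ⋆ FunctionSpaces.Torus.kernel ε) ⋆ FunctionSpaces.Torus.partialDeriv i (FunctionSpaces.Torus.kernel ε) =
        (FunctionSpaces.Torus.partialDeriv i ((fun y => v y j) ⋆ FunctionSpaces.Torus.kernel ε)) ⋆ FunctionSpaces.Torus.kernel ε :=
      funext fun x => FunctionSpaces.Torus.convolution_partialDeriv_right (hw j) hKs i x
    rw [h1]
    have hfg : Integrable (fun y => v y i * v y j) volume := (hvj2 i).integrable_mul (hvj2 j)
    have h2 := FunctionSpaces.Torus.integral_mul_convolution_comm hfg ((hw j).partialDeriv i).integrable hKc (FunctionSpaces.Torus.kernel_neg hε hε')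
    rw [← h2]
    refine integral_congr_ae (Eventually.of_forall fun x => ?_)
    ring
  simp_rw [hpair]
  rw [Finset.sum_comm]
  unfold cetFlux
  have hint : ∀ i j, Integrable (fun x => ((fun y => v y i * v y j) ⋆ FunctionSpaces.Torus.kernel ε) x *
      FunctionSpaces.Torus.partialDeriv i ((fun y => v y j) ⋆ FunctionSpaces.Torus.kernel ε) x) volume := fun i j =>
    ((FunctionSpaces.Torus.continuous_convolution ((hvj2 i).integrable_mul (hvj2 j)) hKc).mul
      ((hw j).partialDeriv i).continuous).integrable_unitAddTorus
  rw [integral_finsetSum _ fun i _ => (integrable_finsetSum _ fun j _ => hint i j)]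
  refine Finset.sum_congr rfl fun i _ => ?_
  rw [integral_finsetSum _ fun j _ => hint i j]

/-- **Identification of the flux limit**: with `Bⱼᵢ(t,x) = ((wⱼ(t,·)) ⋆ ∂ᵢK)(x)`,
`wⱼ = sliceConv Uⱼ K`, `K = K_ε`, and `Uⱼ` a.e. equal to the components of the extended field,
`∑ⱼᵢ ∫ Uⱼ Uᵢ θ Bⱼᵢ = ∫_{(0,T)} θ(t) Π_K[u(t)] dt`. [folklore] -/
theorem integral_sum_mul_cutoff_sliceB_eq (hθT : tsupport θ ⊆ Ioo 0 T)
    (hUc : ∀ j, Uc j =ᵐ[(volume : Measure ℝ).prod volume] fun q => stBar T u q j)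
    (hL3 : ∀ᵐ t ∂(volume.restrict (Ioo 0 T)), MemLp (u t) 3 volume) {ε : ℝ} (hε : 0 < ε)
    (hε' : ε ≤ 1 / 4)
    (hint : ∀ j i, Integrable (fun q : ℝ × UnitAddTorus d => Uc j q * Uc i q *
      (θ q.1 * ((sliceConv (Uc j) (FunctionSpaces.Torus.kernel ε) q.1) ⋆ FunctionSpaces.Torus.partialDeriv i (FunctionSpaces.Torus.kernel ε)) q.2))
      ((volume : Measure ℝ).prod volume)) :
    ∑ j, ∑ i, ∫ q, Uc j q * Uc i q *
        (θ q.1 * ((sliceConv (Uc j) (FunctionSpaces.Torus.kernel ε) q.1) ⋆ FunctionSpaces.Torus.partialDeriv i (FunctionSpaces.Torus.kernel ε)) q.2)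
        ∂((volume : Measure ℝ).prod volume) =
      ∫ t in Ioo 0 T, θ t * cetFlux (FunctionSpaces.Torus.kernel ε) (u t) := by
  set μ : Measure (ℝ × UnitAddTorus d) := (volume : Measure ℝ).prod volume with hμ
  set f : d → d → ℝ × UnitAddTorus d → ℝ := fun j i q => Uc j q * Uc i q *
    (θ q.1 * ((sliceConv (Uc j) (FunctionSpaces.Torus.kernel ε) q.1) ⋆ FunctionSpaces.Torus.partialDeriv i (FunctionSpaces.Torus.kernel ε)) q.2) with hf
  -- sum inside, then iterate the integral
  have hsum : ∑ j, ∑ i, ∫ q, f j i q ∂μ = ∫ q, ∑ j, ∑ i, f j i q ∂μ := by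
    rw [integral_finsetSum _ fun j _ => integrable_finsetSum _ fun i _ => hint j i]
    refine Finset.sum_congr rfl fun j _ => ?_
    rw [integral_finsetSum _ fun i _ => hint j i]
  have hintsum : Integrable (fun q => ∑ j, ∑ i, f j i q) μ :=
    integrable_finsetSum _ fun j _ => integrable_finsetSum _ fun i _ => hint j i
  rw [show (∑ j, ∑ i, ∫ q, Uc j q * Uc i q *
      (θ q.1 * ((sliceConv (Uc j) (FunctionSpaces.Torus.kernel ε) q.1) ⋆ FunctionSpaces.Torus.partialDeriv i (FunctionSpaces.Torus.kernel ε)) q.2) ∂μ) =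
      ∑ j, ∑ i, ∫ q, f j i q ∂μ from rfl, hsum, integral_prod _ hintsum,
    ← integral_indicator measurableSet_Ioo]
  -- slice integrability at a.e. time
  have hslint : ∀ᵐ t ∂(volume : Measure ℝ), ∀ j i, Integrable (fun x => f j i (t, x)) volume := by
    have h : ∀ j i, ∀ᵐ t ∂(volume : Measure ℝ), Integrable (fun x => f j i (t, x)) volume :=
      fun j i => (hint j i).prod_right_ae
    exact ae_all_iff.2 fun j => ae_all_iff.2 fun i => h j i
  have hL3' : ∀ᵐ t ∂(volume : Measure ℝ), t ∈ Ioo 0 T → MemLp (u t) 3 volume :=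
    (ae_restrict_iff' measurableSet_Ioo).1 hL3
  refine integral_congr_ae ?_
  filter_upwards [ae_slice_eq_of_ae_eq_stBar hUc, hL3', hslint] with t hs htL3 htint
  by_cases hmem : t ∈ Ioo 0 T
  · rw [indicator_of_mem hmem]
    have hv := htL3 hmem
    -- replace `Uc j (t, ·)` by `u t · j`
    have hslice : ∀ j, (fun y => Uc j (t, y)) =ᵐ[volume] fun y => u t y j := fun j => by
      filter_upwards [hs j] with y hy
      rw [hy, stBar_apply_of_mem hmem]
    have hw : ∀ j, sliceConv (Uc j) (FunctionSpaces.Torus.kernel ε) t = (fun y => u t y j) ⋆ FunctionSpaces.Torus.kernel ε := fun j =>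
      FunctionSpaces.Torus.convolution_congr_ae_left (ContinuousLinearMap.lsmul ℝ ℝ) (hslice j) _
    have hfi : ∀ j i, (fun x => f j i (t, x)) =ᵐ[volume] fun x => θ t * (u t x j * u t x i *
        (((fun y => u t y j) ⋆ FunctionSpaces.Torus.kernel ε) ⋆ FunctionSpaces.Torus.partialDeriv i (FunctionSpaces.Torus.kernel ε)) x) := by
      intro j i
      filter_upwards [hslice j, hslice i] with x hxj hxi
      simp only [hf, hw j]
      rw [show Uc j (t, x) = u t x j from hxj, show Uc i (t, x) = u t x i from hxi]
      ring
    rw [integral_finsetSum _ fun j _ => integrable_finsetSum _ fun i _ => htint j i]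
    simp_rw [integral_finsetSum _ fun i _ => htint _ i]
    have h2 : ∀ j i, ∫ x, f j i (t, x) = θ t * ∫ x, u t x j * u t x i *
        (((fun y => u t y j) ⋆ FunctionSpaces.Torus.kernel ε) ⋆ FunctionSpaces.Torus.partialDeriv i (FunctionSpaces.Torus.kernel ε)) x := fun j i => by
      rw [integral_congr_ae (hfi j i), integral_const_mul]
    simp_rw [h2, ← Finset.mul_sum]
    rw [sum_integral_mul_sliceB_eq_cetFlux hv hε hε']
  · rw [indicator_of_notMem hmem]
    have hθ0 : θ t = 0 := image_eq_zero_of_notMem_tsupport fun h => hmem (hθT h)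
    have : (fun x => ∑ j, ∑ i, f j i (t, x)) = fun _ => 0 := by
      funext x
      simp [hf, hθ0]
    rw [this, integral_zero]

end Identify

/-! ## F1 assembly: the weak formulation tested with the mollified field -/

section WeakForm

variable [DecidableEq d] {T : ℝ} {u : ℝ → UnitAddTorus d → EuclideanSpace ℝ d}
  {Uc : d → ℝ × UnitAddTorus d → ℝ} {ψc : d → ℝ → UnitAddTorus d → ℝ}

/-- **The weak Euler identity, tested with a vector field of smooth bounded components, read on
`ℝ × T^d` against the extended velocity.** If `ψ = vecField ψc` is an admissible test field with
`∫₀ᵀ∫ (⟪u, ∂ₜψ⟫ + ⟪u, (u·∇)ψ⟫) = 0`, the components `ψc j` being smooth with bounded, jointly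
continuous `∂ₜψⱼ`, `∂ᵢψⱼ`, then for the strongly measurable representatives `Uⱼ` of the components
of the extended velocity `ū = 𝟙_{(0,T)} u`:
`∑ⱼ ∫ Uⱼ ∂ₜψⱼ + ∑ⱼᵢ ∫ Uⱼ Uᵢ ∂ᵢψⱼ = 0` (integrals over `ℝ × T^d`). [folklore] -/
theorem weakForm_rewrite
    (hweak : ∫ t in Ioo 0 T, ∫ x, (⟪u t x, FunctionSpaces.Torus.timeDeriv (vecField ψc) t x⟫_ℝ +
      ⟪u t x, FunctionSpaces.Torus.convect (u t) (vecField ψc t) x⟫_ℝ +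
        0 * ⟪u t x, FunctionSpaces.Torus.laplacian (vecField ψc t) x⟫_ℝ) = 0)
    (hψs : ∀ j, ContDiff ℝ ∞ (FunctionSpaces.Torus.stLift (ψc j)))
    (hdtc : ∀ j, Continuous (uncurry (FunctionSpaces.Torus.timeDeriv (ψc j))))
    (hdxc : ∀ j i, Continuous (uncurry fun t x => FunctionSpaces.Torus.partialDeriv i (ψc j t) x))
    (hdtb : ∀ j, ∃ C, ∀ t x, |FunctionSpaces.Torus.timeDeriv (ψc j) t x| ≤ C)
    (hdxb : ∀ j i, ∃ C, ∀ t x, |FunctionSpaces.Torus.partialDeriv i (ψc j t) x| ≤ C)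
    (hbar1 : Integrable (stBar T u) ((volume : Measure ℝ).prod volume))
    (hbar2 : MemLp (stBar T u) 2 ((volume : Measure ℝ).prod volume))
    (hUc : ∀ j, Uc j =ᵐ[(volume : Measure ℝ).prod volume] fun q => stBar T u q j) :
    ∑ j, ∫ q, Uc j q * FunctionSpaces.Torus.timeDeriv (ψc j) q.1 q.2 ∂((volume : Measure ℝ).prod volume) +
      ∑ j, ∑ i, ∫ q, Uc j q * Uc i q * FunctionSpaces.Torus.partialDeriv i (ψc j q.1) q.2
        ∂((volume : Measure ℝ).prod volume) = 0 := by
  set μ : Measure (ℝ × UnitAddTorus d) := (volume : Measure ℝ).prod volume with hμ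
  -- (a) the integrand, componentwise
  have hslice : ∀ j t, FunctionSpaces.Torus.IsSmooth (ψc j t) := fun j t => isSmooth_slice_of_contDiff_stLift (hψs j) t
  have hdiff : ∀ t x j, DifferentiableAt ℝ (fun τ => ψc j τ x) t := by
    intro t x j
    obtain ⟨y, rfl⟩ := FunctionSpaces.Torus.proj_surjective x
    have h : (fun τ => ψc j τ (FunctionSpaces.Torus.proj y)) = FunctionSpaces.Torus.stLift (ψc j) ∘ fun τ => (τ, y) := rfl
    rw [h]
    exact (((hψs j).differentiable (by simp)).comp
      ((differentiable_id.prodMk (differentiable_const y)))).differentiableAt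
  have hpt : ∀ t x, ⟪u t x, FunctionSpaces.Torus.timeDeriv (vecField ψc) t x⟫_ℝ +
      ⟪u t x, FunctionSpaces.Torus.convect (u t) (vecField ψc t) x⟫_ℝ + 0 * ⟪u t x, FunctionSpaces.Torus.laplacian (vecField ψc t) x⟫_ℝ =
      ∑ j, u t x j * FunctionSpaces.Torus.timeDeriv (ψc j) t x +
        ∑ j, ∑ i, u t x j * u t x i * FunctionSpaces.Torus.partialDeriv i (ψc j t) x := by
    intro t x
    rw [zero_mul, add_zero, inner_timeDeriv_vecField (hdiff t x),
      inner_convect_vecField (fun j => (hslice j t).isContDiff (by simp))]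
    congr 1
    refine Finset.sum_congr rfl fun j _ => ?_
    rw [Finset.mul_sum]
    refine Finset.sum_congr rfl fun i _ => ?_
    ring
  -- (b) the same expression with the extended field, on `ℝ × T^d`
  set Fb : ℝ × UnitAddTorus d → ℝ := fun q => ∑ j, stBar T u q j * FunctionSpaces.Torus.timeDeriv (ψc j) q.1 q.2 +
    ∑ j, ∑ i, stBar T u q j * stBar T u q i * FunctionSpaces.Torus.partialDeriv i (ψc j q.1) q.2 with hFb
  have hbarj : ∀ j, Integrable (fun q => stBar T u q j) μ := fun j =>
    (EuclideanSpace.proj (𝕜 := ℝ) j).integrable_comp hbar1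
  have hbarj2 : ∀ j, MemLp (fun q => stBar T u q j) 2 μ := fun j => hbar2.eval_piLp j
  have hdtm : ∀ j, AEStronglyMeasurable (fun q : ℝ × UnitAddTorus d => FunctionSpaces.Torus.timeDeriv (ψc j) q.1 q.2) μ :=
    fun j => (hdtc j).aestronglyMeasurable
  have hdxm : ∀ j i, AEStronglyMeasurable
      (fun q : ℝ × UnitAddTorus d => FunctionSpaces.Torus.partialDeriv i (ψc j q.1) q.2) μ := fun j i => (hdxc j i).aestronglyMeasurable
  have hA : ∀ j, Integrable (fun q => stBar T u q j * FunctionSpaces.Torus.timeDeriv (ψc j) q.1 q.2) μ := fun j => by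
    obtain ⟨C, hC⟩ := hdtb j
    exact (hbarj j).mul_bdd (hdtm j) (Eventually.of_forall fun q => by
      rw [Real.norm_eq_abs]; exact hC _ _)
  have hB : ∀ j i, Integrable (fun q => stBar T u q j * stBar T u q i * FunctionSpaces.Torus.partialDeriv i (ψc j q.1) q.2) μ :=
    fun j i => by
    obtain ⟨C, hC⟩ := hdxb j i
    exact ((hbarj2 j).integrable_mul (hbarj2 i)).mul_bdd (hdxm j i)
      (Eventually.of_forall fun q => by rw [Real.norm_eq_abs]; exact hC _ _)
  have hFbi : Integrable Fb μ :=
    (integrable_finsetSum _ fun j _ => hA j).add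
      (integrable_finsetSum _ fun j _ => integrable_finsetSum _ fun i _ => hB j i)
  -- (c) from the weak identity to `∫ Fb = 0`
  have hzero : ∫ q, Fb q ∂μ = 0 := by
    rw [integral_prod _ hFbi]
    have h1 : ∫ t, ∫ x, Fb (t, x) = ∫ t in Ioo 0 T, ∫ x, Fb (t, x) := by
      refine (setIntegral_eq_integral_of_forall_compl_eq_zero fun t ht => ?_).symm
      have : (fun x => Fb (t, x)) = fun _ => 0 := by
        funext x
        simp [hFb, stBar_apply_of_not_mem ht]
      rw [this, integral_zero]
    rw [h1]
    have h2 : ∫ t in Ioo 0 T, ∫ x, Fb (t, x) = ∫ t in Ioo 0 T, ∫ x, (⟪u t x, FunctionSpaces.Torus.timeDeriv (vecField ψc) t x⟫_ℝ +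
        ⟪u t x, FunctionSpaces.Torus.convect (u t) (vecField ψc t) x⟫_ℝ +
          0 * ⟪u t x, FunctionSpaces.Torus.laplacian (vecField ψc t) x⟫_ℝ) := by
      refine setIntegral_congr_fun measurableSet_Ioo fun t ht => ?_
      refine integral_congr_ae (Eventually.of_forall fun x => ?_)
      show Fb (t, x) = ⟪u t x, FunctionSpaces.Torus.timeDeriv (vecField ψc) t x⟫_ℝ +
        ⟪u t x, FunctionSpaces.Torus.convect (u t) (vecField ψc t) x⟫_ℝ + 0 * ⟪u t x, FunctionSpaces.Torus.laplacian (vecField ψc t) x⟫_ℝ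
      rw [hpt t x]
      simp [hFb, stBar_apply_of_mem ht]
    rw [h2]
    exact hweak
  -- (d) replace the extended field by its representatives and split
  have hae : ∀ᵐ q ∂μ, ∀ j, Uc j q = stBar T u q j := ae_all_iff.2 fun j => hUc j
  have hA' : ∀ j, Integrable (fun q => Uc j q * FunctionSpaces.Torus.timeDeriv (ψc j) q.1 q.2) μ := fun j =>
    (hA j).congr (hae.mono fun q hq => by simp only [hq j])
  have hB' : ∀ j i, Integrable (fun q => Uc j q * Uc i q * FunctionSpaces.Torus.partialDeriv i (ψc j q.1) q.2) μ :=
    fun j i => (hB j i).congr (hae.mono fun q hq => by simp only [hq j, hq i])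
  have hFb' : ∫ q, Fb q ∂μ = ∫ q, (∑ j, Uc j q * FunctionSpaces.Torus.timeDeriv (ψc j) q.1 q.2 +
      ∑ j, ∑ i, Uc j q * Uc i q * FunctionSpaces.Torus.partialDeriv i (ψc j q.1) q.2) ∂μ := by
    refine integral_congr_ae (hae.mono fun q hq => ?_)
    simp only [hFb, hq]
  rw [hzero] at hFb'
  rw [integral_add (integrable_finsetSum _ fun j _ => hA' j)
    (integrable_finsetSum _ fun j _ => integrable_finsetSum _ fun i _ => hB' j i),
    integral_finsetSum _ fun j _ => hA' j,
    integral_finsetSum _ fun j _ => integrable_finsetSum _ fun i _ => hB' j i] at hFb'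
  simp_rw [integral_finsetSum _ fun i _ => hB' _ i] at hFb'
  exact hFb'.symm

end WeakForm

/-! ## F1: the discharge -/

section Discharge

variable [DecidableEq d]

omit [Fintype d] [DecidableEq d] in
/-- The space–time lift of a component vector field. [folklore] -/
theorem stLift_vecField (ψc : d → ℝ → UnitAddTorus d → ℝ) :
    FunctionSpaces.Torus.stLift (vecField ψc) = fun q => WithLp.toLp 2 fun j => FunctionSpaces.Torus.stLift (ψc j) q := rfl

/-- **Discharge of `IsWeakEulerSolutionOn.energyBalance_vecConv`** (CCFS 2008, §3.2, (11), in
the tree's mollifier transcription): for a weak Euler solution `u` on `T^d × (0,T)` with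
`u ∈ L³_{t,x}`, `K = K_ε`, and `θ ∈ C_c^∞(0,T)`,
`∫₀ᵀ θ' E(u(t) ⋆ K) dt = -∫₀ᵀ θ Π_K[u(t)] dt`. Proof: test the weak formulation with the doubly
mollified cut-off fields `ψₙ = ρₙ ⋆ₜ (θ · ((ρₙ ⋆ₜ ū) ⋆ₓ K) ⋆ₓ K)` (normalised bumps `ρₙ` in time
with `rOut → 0`, `ū = 𝟙_{(0,T)} u`), which are smooth space–time test fields compactly supported
in `(0,T)` and divergence free; the time-derivative pairing is exactly `∫ θ' E((ρₙ ⋆ₜ ū) ⋆ K)`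
(`integral_mul_timeDeriv_cetTest`), which tends to `∫ θ' E(u ⋆ K)`; the convective pairing tends
to `∫ θ Π_K[u]` (`L³` convergence of iterated time mollifications against `ūᵢūⱼ ∈ L^{3/2}`,
evenness of `K` and `(f ⋆ K) ⋆ ∂ᵢK = (f ⋆ ∂ᵢK) ⋆ K`). [cite: CCFS2008, §3.2 eq. (11)] -/
theorem energyBalance_vecConv_holds : FunctionSpaces.Torus.IsWeakEulerSolutionOn.energyBalance_vecConv (d := d) := by
  intro T u hu hu3 ε hε hε' θ hθ hθc hθT
  -- degenerate time interval
  rcases le_or_gt T 0 with hT | hT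
  · simp [Ioo_eq_empty_of_le hT, Measure.restrict_empty]
  set μ : Measure (ℝ × UnitAddTorus d) := (volume : Measure ℝ).prod volume with hμ
  -- the kernel
  have hKs : FunctionSpaces.Torus.IsSmooth (FunctionSpaces.Torus.kernel (d := d) ε) := FunctionSpaces.Torus.isSmooth_kernel hε hε'
  have hKc : Continuous (FunctionSpaces.Torus.kernel (d := d) ε) := hKs.continuous
  have hKeven : ∀ z : UnitAddTorus d, FunctionSpaces.Torus.kernel ε (-z) = FunctionSpaces.Torus.kernel ε z := FunctionSpaces.Torus.kernel_neg hε hε'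
  -- the support of `θ`
  obtain ⟨a, b, ha, hab, hb, hθab⟩ := FunctionSpaces.exists_Icc_subset_Ioo_of_tsupport_subset hT hθc hθT
  set δ₀ : ℝ := min a (T - b) / 2 with hδ₀
  have hδ₀pos : 0 < δ₀ := by
    have : 0 < min a (T - b) := lt_min ha (by linarith)
    positivity
  have hδ₀a : δ₀ < a := by
    have := min_le_left a (T - b); rw [hδ₀]; linarith [lt_min ha (show 0 < T - b by linarith)]
  have hδ₀b : b + δ₀ < T := by
    have := min_le_right a (T - b); rw [hδ₀]; linarith [lt_min ha (show 0 < T - b by linarith)]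
  obtain ⟨φ, hφlt, hφ0⟩ := exists_contDiffBump_seq_lt hδ₀pos
  -- measurability and integrability of the (extended) velocity
  have hm : AEStronglyMeasurable (uncurry u) ((volume.restrict (Ioo 0 T)).prod volume) := by
    have h := FunctionSpaces.Torus.aestronglyMeasurable_uncurry_of_stLift_restrict hu.1
    rwa [Measure.volume_eq_prod, ← Measure.prod_restrict, Measure.restrict_univ] at h
  have hbar1 : Integrable (stBar T u) μ := integrable_stBar hm hu.2.1
  have hbar2 : MemLp (stBar T u) 2 μ := by
    have := memLp_stBar hm two_ne_zero hu.2.1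
    simpa using this
  have hbar3 : MemLp (stBar T u) 3 μ := by
    have := memLp_stBar hm (by norm_num : (3 : ℕ) ≠ 0) hu3
    simpa using this
  -- strongly measurable representatives of the components
  have hsm : ∀ j, AEStronglyMeasurable (fun q => stBar T u q j) μ := fun j => (hbar2.eval_piLp j).1
  set Uc : d → ℝ × UnitAddTorus d → ℝ := fun j => (hsm j).mk _ with hUcdef
  have hUm : ∀ j, StronglyMeasurable (Uc j) := fun j => (hsm j).stronglyMeasurable_mk
  have hUc : ∀ j, Uc j =ᵐ[μ] fun q => stBar T u q j := fun j => (hsm j).ae_eq_mk.symm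
  have hU1 : ∀ j, Integrable (Uc j) μ := fun j =>
    ((EuclideanSpace.proj (𝕜 := ℝ) j).integrable_comp hbar1).congr (hsm j).ae_eq_mk
  have hU2 : ∀ j, MemLp (Uc j) 2 μ := fun j => (hbar2.eval_piLp j).ae_eq (hsm j).ae_eq_mk
  have hU3 : ∀ j, MemLp (Uc j) 3 μ := fun j => (hbar3.eval_piLp j).ae_eq (hsm j).ae_eq_mk
  have hU32 : ∀ j i, MemLp (fun q => Uc j q * Uc i q) (3 / 2) μ := fun j i => by
    haveI := FunctionSpaces.holderTriple_three_three
    exact (hU3 i).mul (hU3 j)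
  -- weak divergence-freeness of the representatives' slices
  have hL3 : ∀ᵐ t ∂(volume.restrict (Ioo 0 T)), MemLp (u t) 3 volume :=
    ae_memLp_three_of_lintegral hm hu3
  have hL1 : ∀ᵐ t ∂(volume.restrict (Ioo 0 T)), Integrable (u t) volume :=
    hL3.mono fun t ht => ht.integrable (by norm_num)
  have hdivae : ∀ᵐ r ∂(volume : Measure ℝ), ∀ z, ∑ j, ((fun y => Uc j (r, y)) ⋆ FunctionSpaces.Torus.partialDeriv j (FunctionSpaces.Torus.kernel ε)) z = 0 := by
    have hdiv' : ∀ᵐ t ∂(volume : Measure ℝ), t ∈ Ioo 0 T → FunctionSpaces.Torus.IsWeaklyDivFree (u t) :=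
      (ae_restrict_iff' measurableSet_Ioo).1 hu.2.2.1
    have hL1' : ∀ᵐ t ∂(volume : Measure ℝ), t ∈ Ioo 0 T → Integrable (u t) volume :=
      (ae_restrict_iff' measurableSet_Ioo).1 hL1
    filter_upwards [ae_slice_eq_of_ae_eq_stBar hUc, hdiv', hL1'] with r hs hrdiv hrL1
    intro z
    by_cases hr : r ∈ Ioo 0 T
    · have hslice : ∀ j, (fun y => Uc j (r, y)) =ᵐ[volume] fun y => u r y j := fun j => by
        filter_upwards [hs j] with y hy
        rw [hy, stBar_apply_of_mem hr]
      have : ∀ j, ((fun y => Uc j (r, y)) ⋆ FunctionSpaces.Torus.partialDeriv j (FunctionSpaces.Torus.kernel ε)) z =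
          ((fun y => u r y j) ⋆ FunctionSpaces.Torus.partialDeriv j (FunctionSpaces.Torus.kernel ε)) z := fun j => by
        rw [FunctionSpaces.Torus.convolution_congr_ae_left (ContinuousLinearMap.lsmul ℝ ℝ) (hslice j)]
      simp_rw [this]
      exact sum_convolution_partialDeriv_eq_zero (hrL1 hr) (hrdiv hr) hKs z
    · have hslice : ∀ j, (fun y => Uc j (r, y)) =ᵐ[volume] fun _ => (0 : ℝ) := fun j => by
        filter_upwards [hs j] with y hy
        rw [hy, stBar_apply_of_not_mem hr]
        rfl
      have : ∀ j, ((fun y => Uc j (r, y)) ⋆ FunctionSpaces.Torus.partialDeriv j (FunctionSpaces.Torus.kernel ε)) z = 0 := fun j => by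
        rw [FunctionSpaces.Torus.convolution_congr_ae_left (ContinuousLinearMap.lsmul ℝ ℝ) (hslice j)]
        have : (fun _ : UnitAddTorus d => (0 : ℝ)) = 0 := rfl
        rw [this, zero_convolution]
        rfl
      simp [this]
  -- the time kernels
  set ρ : ℕ → ℝ → ℝ := fun n => (φ n).normed volume with hρdef
  have hρs : ∀ n, ContDiff ℝ ∞ (ρ n) := fun n => (φ n).contDiff_normed
  have hρc : ∀ n, HasCompactSupport (ρ n) := fun n => (φ n).hasCompactSupport_normed
  have hρeven : ∀ n r, ρ n (-r) = ρ n r := fun n r => (φ n).normed_neg r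
  have hρsupp : ∀ n r, ρ n r ≠ 0 → |r| < δ₀ := fun n r h =>
    (abs_lt_of_normed_ne_zero (φ n) h).trans (hφlt n)
  have hρ1 : ∀ n, ContDiff ℝ 1 (ρ n) := fun n => (hρs n).of_le (by norm_cast)
  have hK1 : FunctionSpaces.Torus.IsContDiff 1 (FunctionSpaces.Torus.kernel (d := d) ε) := hKs.isContDiff (by simp)
  -- the test fields and their admissibility
  set ψc : ℕ → d → ℝ → UnitAddTorus d → ℝ := fun n j => cetTest (ρ n) (FunctionSpaces.Torus.kernel ε) θ (Uc j) with hψcdef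
  have hG : ∀ n j, Integrable (fun p : ℝ × UnitAddTorus d => θ p.1 * FunctionSpaces.Torus.stConv (ρ n) (FunctionSpaces.Torus.kernel ε) (Uc j) p.1 p.2) μ :=
    fun n j => integrable_cutoff_stConv (hU1 j) (hρs n) (hρc n) hKs hθ hθc
  have hψs : ∀ n j, ContDiff ℝ ∞ (FunctionSpaces.Torus.stLift (ψc n j)) := fun n j =>
    contDiff_stLift_cetTest (hU1 j) (hρs n) (hρc n) hKs hθ hθc
  have hψzero : ∀ n t, (t ≤ a - δ₀ ∨ b + δ₀ ≤ t) → vecField (ψc n) t = 0 := by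
    intro n t ht
    funext x
    ext j
    simp only [vecField_apply, hψcdef]
    rw [cetTest_eq_zero_of_dist hθab (hρsupp n) ht x]
    rfl
  have htest : ∀ n, FunctionSpaces.Torus.IsSpaceTimeTestIoo T (vecField (ψc n)) := fun n =>
    ⟨⟨by rw [stLift_vecField]; exact contDiff_piLp' (p := 2) fun j => hψs n j,
      b + δ₀, hδ₀b, fun t ht => hψzero n t (Or.inr ht)⟩,
      a - δ₀, by linarith, fun t ht => hψzero n t (Or.inl ht)⟩
  have hdivt : ∀ n, FunctionSpaces.Torus.IsDivFreeTest (vecField (ψc n)) := fun n t =>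
    isDivFree_cetTest hU1 (hρs n) (hρc n) hKs hθ hθc hdivae t
  have hweak : ∀ n, ∫ t in Ioo 0 T, ∫ x, (⟪u t x, FunctionSpaces.Torus.timeDeriv (vecField (ψc n)) t x⟫_ℝ +
      ⟪u t x, FunctionSpaces.Torus.convect (u t) (vecField (ψc n) t) x⟫_ℝ +
        0 * ⟪u t x, FunctionSpaces.Torus.laplacian (vecField (ψc n) t) x⟫_ℝ) = 0 := fun n =>
    hu.2.2.2 _ (htest n) (hdivt n)
  -- derivative formulas for the components, continuity and bounds
  have hdt : ∀ n j t x, FunctionSpaces.Torus.timeDeriv (ψc n j) t x =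
      FunctionSpaces.Torus.stConv (deriv (ρ n)) (FunctionSpaces.Torus.kernel ε) (fun p => θ p.1 * FunctionSpaces.Torus.stConv (ρ n) (FunctionSpaces.Torus.kernel ε) (Uc j) p.1 p.2) t x :=
    fun n j t x => FunctionSpaces.Torus.timeDeriv_stConv (hG n j) (hρ1 n) (hρc n) hK1 t x
  have hdx : ∀ n j i t x, FunctionSpaces.Torus.partialDeriv i (ψc n j t) x =
      FunctionSpaces.Torus.stConv (ρ n) (FunctionSpaces.Torus.partialDeriv i (FunctionSpaces.Torus.kernel ε)) (fun p => θ p.1 * FunctionSpaces.Torus.stConv (ρ n) (FunctionSpaces.Torus.kernel ε) (Uc j) p.1 p.2) t x :=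
    fun n j i t x => FunctionSpaces.Torus.partialDeriv_stConv (hG n j) (hρ1 n) (hρc n) hK1 i t x
  have hdtc : ∀ n j, Continuous (uncurry (FunctionSpaces.Torus.timeDeriv (ψc n j))) := fun n j => by
    have : uncurry (FunctionSpaces.Torus.timeDeriv (ψc n j)) = uncurry (FunctionSpaces.Torus.stConv (deriv (ρ n)) (FunctionSpaces.Torus.kernel ε)
        (fun p => θ p.1 * FunctionSpaces.Torus.stConv (ρ n) (FunctionSpaces.Torus.kernel ε) (Uc j) p.1 p.2)) := by
      funext q; exact hdt n j q.1 q.2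
    rw [this]
    exact FunctionSpaces.Torus.continuous_uncurry_of_continuous_stLift
      (FunctionSpaces.Torus.contDiff_top_stLift_stConv (hG n j) (hρs n).deriv' (hρc n).deriv hKs).continuous
  have hdxc : ∀ n j i, Continuous (uncurry fun t x => FunctionSpaces.Torus.partialDeriv i (ψc n j t) x) := fun n j i => by
    have : (uncurry fun t x => FunctionSpaces.Torus.partialDeriv i (ψc n j t) x) = uncurry (FunctionSpaces.Torus.stConv (ρ n) (FunctionSpaces.Torus.partialDeriv i (FunctionSpaces.Torus.kernel ε))
        (fun p => θ p.1 * FunctionSpaces.Torus.stConv (ρ n) (FunctionSpaces.Torus.kernel ε) (Uc j) p.1 p.2)) := by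
      funext q; exact hdx n j i q.1 q.2
    rw [this]
    exact FunctionSpaces.Torus.continuous_uncurry_of_continuous_stLift
      (FunctionSpaces.Torus.contDiff_top_stLift_stConv (hG n j) (hρs n) (hρc n) (hKs.partialDeriv i)).continuous
  have hdtb : ∀ n j, ∃ C, ∀ t x, |FunctionSpaces.Torus.timeDeriv (ψc n j) t x| ≤ C := fun n j => by
    obtain ⟨C, hC⟩ := exists_abs_stConv_le (hG n j) ((hρs n).continuous_deriv (by simp)) (hρc n).deriv hKc
    exact ⟨C, fun t x => by rw [hdt]; exact hC t x⟩
  have hdxb : ∀ n j i, ∃ C, ∀ t x, |FunctionSpaces.Torus.partialDeriv i (ψc n j t) x| ≤ C := fun n j i => by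
    obtain ⟨C, hC⟩ := exists_abs_stConv_le (hG n j) (hρs n).continuous (hρc n)
      (hKs.partialDeriv i).continuous
    exact ⟨C, fun t x => by rw [hdx]; exact hC t x⟩
  -- (Eₙ): the rewritten weak identity
  have hEn : ∀ n, ∑ j, ∫ q, Uc j q * FunctionSpaces.Torus.timeDeriv (ψc n j) q.1 q.2 ∂μ +
      ∑ j, ∑ i, ∫ q, Uc j q * Uc i q * FunctionSpaces.Torus.partialDeriv i (ψc n j q.1) q.2 ∂μ = 0 := fun n =>
    weakForm_rewrite (hweak n) (hψs n) (hdtc n) (hdxc n) (hdtb n) (hdxb n) hbar1 hbar2 hUc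
  -- bounds for `θ`, `θ'`
  obtain ⟨Cθ, hCθ⟩ := FunctionSpaces.exists_forall_abs_le_of_hasCompactSupport hθ.continuous hθc
  have hθ'c : Continuous (deriv θ) := hθ.continuous_deriv (by simp)
  obtain ⟨Cθ', hCθ'⟩ := FunctionSpaces.exists_forall_abs_le_of_hasCompactSupport hθ'c hθc.deriv
  -- the space-mollified slices `wⱼ` and the second-level slices `Bⱼᵢ`
  set w : d → ℝ → UnitAddTorus d → ℝ := fun j => sliceConv (Uc j) (FunctionSpaces.Torus.kernel ε) with hwdef
  have hw_sm : ∀ j, StronglyMeasurable (uncurry (w j)) := fun j =>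
    stronglyMeasurable_uncurry_sliceConv (hUm j) hKc
  have hKint : ∫⁻ y, ‖FunctionSpaces.Torus.kernel (d := d) ε y‖ₑ < ⊤ := hKc.integrable_unitAddTorus.2
  have hw2 : ∀ j, eLpNorm (uncurry (w j)) 2 μ < ⊤ := fun j =>
    (eLpNorm_uncurry_sliceConv_le (hUm j) hKc one_le_two ENNReal.ofNat_ne_top).trans_lt
      (ENNReal.mul_lt_top hKint (hU2 j).2)
  have hw3 : ∀ j, eLpNorm (uncurry (w j)) 3 μ < ⊤ := fun j =>
    (eLpNorm_uncurry_sliceConv_le (hUm j) hKc (by norm_num) (by norm_num)).trans_lt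
      (ENNReal.mul_lt_top hKint (hU3 j).2)
  set B : d → d → ℝ → UnitAddTorus d → ℝ := fun j i r x => ((w j r) ⋆ FunctionSpaces.Torus.partialDeriv i (FunctionSpaces.Torus.kernel ε)) x
    with hBdef
  have hB_sm : ∀ j i, StronglyMeasurable (uncurry (B j i)) := fun j i =>
    stronglyMeasurable_uncurry_sliceConv (U := uncurry (w j)) (hw_sm j) (hKs.partialDeriv i).continuous
  have hB3 : ∀ j i, eLpNorm (uncurry (B j i)) 3 μ < ⊤ := fun j i =>
    (eLpNorm_uncurry_sliceConv_le (U := uncurry (w j)) (hw_sm j) (hKs.partialDeriv i).continuous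
      (by norm_num) (by norm_num)).trans_lt
      (ENNReal.mul_lt_top ((hKs.partialDeriv i).continuous.integrable_unitAddTorus.2) (hw3 j))
  ---------------------------------------------------------------- Term 1
  set A : ℕ → d → ℝ := fun n j => ∫ q, deriv θ q.1 *
    (((ρ n) ⋆ fun r => w j r q.2) q.1) ^ 2 ∂μ with hAdef
  set Ainf : d → ℝ := fun j => ∫ q, deriv θ q.1 * (w j q.1 q.2) ^ 2 ∂μ with hAinfdef
  -- `θ' ⊗ 1` is integrable on `ℝ × T^d`
  have hθ'i : Integrable (fun p : ℝ × UnitAddTorus d => deriv θ p.1) μ := by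
    have h1 : Integrable (deriv θ) (volume : Measure ℝ) := hθ'c.integrable_of_hasCompactSupport hθc.deriv
    have := h1.mul_prod (f := deriv θ) (g := fun _ : UnitAddTorus d => (1 : ℝ))
      (integrable_const (μ := (volume : Measure (UnitAddTorus d))) (1 : ℝ))
    simpa using this
  have hT1form : ∀ n j, ∫ q, Uc j q * FunctionSpaces.Torus.timeDeriv (ψc n j) q.1 q.2 ∂μ = 2⁻¹ * A n j := by
    intro n j
    rw [show ψc n j = cetTest (ρ n) (FunctionSpaces.Torus.kernel ε) θ (Uc j) from rfl,
      integral_mul_timeDeriv_cetTest (hU1 j) (hρs n) (hρc n) (hρeven n) hKs hKeven hθ hθc]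
    congr 1
    -- iterated integral to product integral
    obtain ⟨M, hM⟩ := exists_abs_stConv_le (hU1 j) (hρs n).continuous (hρc n) hKc
    have hWc : Continuous (uncurry (FunctionSpaces.Torus.stConv (ρ n) (FunctionSpaces.Torus.kernel ε) (Uc j))) :=
      FunctionSpaces.Torus.continuous_uncurry_of_continuous_stLift (FunctionSpaces.Torus.contDiff_top_stLift_stConv (hU1 j) (hρs n) (hρc n) hKs).continuous
    have hint : Integrable (fun q : ℝ × UnitAddTorus d => deriv θ q.1 *
        (FunctionSpaces.Torus.stConv (ρ n) (FunctionSpaces.Torus.kernel ε) (Uc j) q.1 q.2) ^ 2) μ :=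
      hθ'i.mul_bdd (c := M ^ 2) ((hWc.pow 2).aestronglyMeasurable) (Eventually.of_forall fun q => by
        rw [Real.norm_eq_abs, abs_pow]
        exact pow_le_pow_left₀ (abs_nonneg _) (hM _ _) 2)
    have heq : A n j = ∫ q, deriv θ q.1 * (FunctionSpaces.Torus.stConv (ρ n) (FunctionSpaces.Torus.kernel ε) (Uc j) q.1 q.2) ^ 2 ∂μ := by
      refine integral_congr_ae (Eventually.of_forall fun q => ?_)
      exact congrArg (fun v : ℝ => deriv θ q.1 * v ^ 2)
        (FunctionSpaces.Torus.stConv_eq_timeConv (hU1 j) (hρs n).continuous (hρc n) hKc q.1 q.2).symm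
    rw [heq, integral_prod _ hint]
    refine integral_congr_ae (Eventually.of_forall fun s => ?_)
    exact (integral_const_mul _ _).symm
  have hT1lim : Tendsto (fun n => ∑ j, 2⁻¹ * A n j) atTop (𝓝 (∑ j, 2⁻¹ * Ainf j)) := by
    refine tendsto_finsetSum _ fun j _ => ?_
    refine (tendsto_integral_cutoff_sq_timeConv (μ := (volume : Measure (UnitAddTorus d))) hφ0
      (hw_sm j) (hw2 j) hθ'c hCθ').const_mul 2⁻¹
  have hT1id : ∑ j, 2⁻¹ * Ainf j = ∫ s in Ioo 0 T, deriv θ s * FunctionSpaces.Torus.kineticEnergy (vecConv (u s) (FunctionSpaces.Torus.kernel ε)) := by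
    rw [← integral_deriv_mul_sum_sq_sliceConv_eq hθT hUc hL1 hKc]
    -- `Ainf j` as an iterated integral
    have hwint : ∀ j, Integrable (fun q : ℝ × UnitAddTorus d => deriv θ q.1 * (w j q.1 q.2) ^ 2) μ := by
      intro j
      have hw' : MemLp (uncurry (w j)) 2 μ := ⟨(hw_sm j).aestronglyMeasurable, hw2 j⟩
      have h2 : Integrable (fun q => (uncurry (w j) q) ^ 2) μ := by
        have := hw'.integrable_mul hw'
        refine this.congr (Eventually.of_forall fun q => ?_)
        simp only [Pi.mul_apply, sq]
      exact h2.bdd_mul ((hθ'c.measurable.comp measurable_fst).aestronglyMeasurable)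
        (Eventually.of_forall fun q => by rw [Real.norm_eq_abs]; exact hCθ' _)
    have hAinf : ∀ j, Ainf j = ∫ s, deriv θ s * ∫ z, (w j s z) ^ 2 := fun j => by
      simp only [hAinfdef]
      rw [integral_prod _ (hwint j)]
      refine integral_congr_ae (Eventually.of_forall fun s => ?_)
      show ∫ y, deriv θ s * (w j s y) ^ 2 = deriv θ s * ∫ z, (w j s z) ^ 2
      exact integral_const_mul _ _
    have hslint : ∀ j, Integrable (fun s => deriv θ s * ∫ z, (w j s z) ^ 2) (volume : Measure ℝ) := by
      intro j
      have := (hwint j).integral_prod_left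
      refine this.congr (Eventually.of_forall fun s => ?_)
      show ∫ y, deriv θ s * (w j s y) ^ 2 = deriv θ s * ∫ z, (w j s z) ^ 2
      exact integral_const_mul _ _
    simp_rw [hAinf]
    rw [← Finset.mul_sum, ← integral_finsetSum _ fun j _ => hslint j, ← integral_const_mul]
    refine integral_congr_ae (Eventually.of_forall fun s => ?_)
    show 2⁻¹ * ∑ i, deriv θ s * ∫ z, (w i s z) ^ 2 =
      deriv θ s * (2⁻¹ * ∑ j, ∫ z, (sliceConv (Uc j) (FunctionSpaces.Torus.kernel ε) s z) ^ 2)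
    simp only [Finset.mul_sum, hwdef]
    refine Finset.sum_congr rfl fun j _ => ?_
    ring
  ---------------------------------------------------------------- Term 2
  set g : ℕ → d → d → ℝ × UnitAddTorus d → ℝ := fun n j i q => FunctionSpaces.Torus.partialDeriv i (ψc n j q.1) q.2 with hgdef
  set ginf : d → d → ℝ × UnitAddTorus d → ℝ := fun j i q => θ q.1 * B j i q.1 q.2 with hginfdef
  have hgform : ∀ n j i, g n j i = fun q => ((ρ n) ⋆ fun s => θ s * ((ρ n) ⋆ fun r => B j i r q.2) s) q.1 := by
    intro n j i
    funext q
    simp only [hgdef]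
    rw [show ψc n j = cetTest (ρ n) (FunctionSpaces.Torus.kernel ε) θ (Uc j) from rfl,
      partialDeriv_cetTest_eq (hUm j) (hU1 j) (hρs n) (hρc n) hKs hθ hθc i q.1 q.2]
  have hginf : ∀ j i, MemLp (ginf j i) 3 μ := by
    intro j i
    refine ⟨((hθ.continuous.measurable.comp measurable_fst).stronglyMeasurable.mul (hB_sm j i)).aestronglyMeasurable, ?_⟩
    refine lt_of_le_of_lt (eLpNorm_le_mul_eLpNorm_of_ae_le_mul (g := uncurry (B j i)) (c := Cθ)
      (Eventually.of_forall fun q => ?_) 3) (ENNReal.mul_lt_top ENNReal.ofReal_lt_top (hB3 j i))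
    simp only [hginfdef, uncurry, norm_mul, Real.norm_eq_abs]
    exact mul_le_mul_of_nonneg_right (hCθ _) (abs_nonneg _)
  have hconv : ∀ j i, Tendsto (fun n => eLpNorm (fun q => g n j i q - ginf j i q) 3 μ) atTop (𝓝 0) := by
    intro j i
    simp_rw [hgform]
    exact tendsto_eLpNorm_iteratedTimeConv_sub (μ := (volume : Measure (UnitAddTorus d))) hφ0 (hB_sm j i)
      (by norm_num) (by norm_num) (hB3 j i) hθ.continuous hCθ
  have hT2lim : Tendsto (fun n => ∑ j, ∑ i, ∫ q, Uc j q * Uc i q * g n j i q ∂μ) atTop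
      (𝓝 (∑ j, ∑ i, ∫ q, Uc j q * Uc i q * ginf j i q ∂μ)) := by
    refine tendsto_finsetSum _ fun j _ => tendsto_finsetSum _ fun i _ => ?_
    exact tendsto_integral_mul_of_tendsto_eLpNorm_three (f := fun q => Uc j q * Uc i q) (hU32 j i)
      (fun n => (hdxc n j i).aestronglyMeasurable) (hginf j i) (hconv j i)
  have hT2id : ∑ j, ∑ i, ∫ q, Uc j q * Uc i q * ginf j i q ∂μ =
      ∫ t in Ioo 0 T, θ t * cetFlux (FunctionSpaces.Torus.kernel ε) (u t) := by
    haveI := FunctionSpaces.holderTriple_threeHalves_three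
    have hint : ∀ j i, Integrable (fun q => Uc j q * Uc i q * ginf j i q) μ := fun j i => by
      have := (hU32 j i).integrable_mul (hginf j i)
      exact this
    exact integral_sum_mul_cutoff_sliceB_eq hθT hUc hL3 hε hε' hint
  ---------------------------------------------------------------- conclusion
  have hsum : Tendsto (fun n => ∑ j, 2⁻¹ * A n j + ∑ j, ∑ i, ∫ q, Uc j q * Uc i q * g n j i q ∂μ) atTop
      (𝓝 (∑ j, 2⁻¹ * Ainf j + ∑ j, ∑ i, ∫ q, Uc j q * Uc i q * ginf j i q ∂μ)) := hT1lim.add hT2lim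
  have hzero : (fun n => ∑ j, 2⁻¹ * A n j + ∑ j, ∑ i, ∫ q, Uc j q * Uc i q * g n j i q ∂μ) = fun _ => 0 := by
    funext n
    have h := hEn n
    simp_rw [hT1form n] at h
    exact h
  rw [hzero] at hsum
  have hlim := tendsto_nhds_unique (tendsto_const_nhds) hsum
  rw [hT1id, hT2id] at hlim
  linarith

end Discharge

end Torus

end Literature.Analysis.FluidPDE
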